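import Literature.MathematicalPhysics.QuantumManyBody.DiluteBoseGasUpperBound
import Literature.MathematicalPhysics.QuantumManyBody.DiluteBoseGasLHYUpperBound
import Literature.MathematicalPhysics.QuantumManyBody.BoseGasDirichletMonotonicity
import HarnessLib

/-!
# Basti–Cenatiempo–Schlein 2021, Theorem 1.1: the replication machinery of its Appendix A
# (symmetrised products of Dirichlet states in separated boxes; the thermodynamic `limsup` is
# bounded by any finite block)

Topic `Literature/MathematicalPhysics/QuantumManyBody`, proofs companion of
`DiluteBoseGasUpperBound.lean` (provefact
`Literature.MathematicalPhysics.QuantumManyBody.BoseGas.BastiCenatiempoSchlein2021_upperBound`).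
The printed proof of [BastiCenatiempoSchlein2021, Thm. 1.1] (Forum Math. Sigma 9 (2021) e74,
arXiv:2101.06222) is Prop. 1.3 (a grand-canonical periodic trial state with the Lee–Huang–Yang
energy on a box of side `ρ̃^{-γ}`, §§2–5 — NOT formalised here) followed by the localisation
Prop. 1.2, whose "standard proof [R, YY, Aaen]" is App. A: Lemma A.1 (periodic → Dirichlet by
cosine cut-offs), **Lemma A.2** (replication of a Dirichlet state into `t³` translated copies
"separated by corridors of size `R` (to avoid interactions between different boxes)", the copies
being combined by "the symmetrization of (A.7)", with `‖Ψ‖ = 1`, `⟨Ψ, 𝓗Ψ⟩ = t³⟨Ψ_{L+2ℓ}, 𝓗Ψ_{L+2ℓ}⟩`),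
Lemma A.3 (Legendre duality) and Lemma A.4 (grand-canonical → canonical, using the existence and
convexity of the thermodynamic limit [Ruelle 1969] and the canonical replication bound **(A.13)**
`e_{L'}(ρ/(1+R/L)³) ≤ e_L(ρ)/(1+R/L)³`, proved by "placing `r³` copies of the state `ψ` in adjacent
boxes and using that (thanks to the corridors of size `R` between the boxes) particles in
different boxes do not interact").

This file PROVES, for the tree's variational Dirichlet objects (`TrialState`, `energy`,
`groundStateEnergy = E₀^D`, `sideLength` of `BoseEinsteinCondensation.lean`), the canonical
replication machinery of Lemma A.2/(A.13) and its thermodynamic consequence: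

* `exists_merge` — **the symmetrised tensor product.** Two `C¹`, Bose-symmetric, normalised wave
  functions of `N₁` and `N₂` particles living in sets `U₁`, `U₂ ⊂ ℝ³` with disjoint closures at
  mutual distance `> R ⊇ supp v` merge into a `C¹`, Bose-symmetric, normalised `(N₁+N₂)`-particle
  wave function living in `U₁ ∪ U₂` whose energy `∫|∇Ψ|² + ∑_{i<j} v|Ψ|²` is the SUM of the two
  energies. Construction: `Ψ = κ^{-1/2} ∑_{|S| = N₁} ψ₁(X_{σ_S(block 1)}) ψ₂(X_{σ_S(block 2)})` over the
  `N₁`-subsets `S` of the labels, `σ_S` a permutation adapted to `S`; distinct `S` give products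
  with disjoint supports, even locally (`blockProd_eventuallyEq_zero_or`), so `|Ψ|²` and `|∇Ψ|²`
  are sums of squares (`ennnorm_merge_sq`, `kineticDensity_merge`), each computed by relabelling
  invariance of Lebesgue measure and block Tonelli (`lintegral_perm_block_mul`), the product rule
  (`kineticDensity_blockProd`) and the absence of cross interactions
  (`interaction_mul_ennnorm_blockProd_sq`).
* `groundStateEnergy_add_le_add` — two separated translated boxes inside `Λ_L`:
  `E₀^D(N₁+N₂, L) ≤ E₀^D(N₁, L₁) + E₀^D(N₂, L₂)`.
* `exists_replicate`, `groundStateEnergy_mul_le`, `groundStateEnergy_lattice_le` — `K` separated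
  translates, in particular the cubic lattice `dℤ³ ∩ [0, kd)³` with `L₀ + R < d`:
  **`E₀^D(N₀k³, kd) ≤ k³ E₀^D(N₀, L₀)`** (Lemma A.2 / (A.13) in canonical form).
* `limsup_energyDensity_le_of_block` — **the thermodynamic `limsup` along `L_N = (N/ρ)^{1/3}` is
  bounded by any finite block packable above density `ρ`**: if `L₀ + R < d` and `ρd³ < N₀` then
  `limsup_N E₀^D(N, L_N)/L_N³ ≤ (ρ/N₀) E₀^D(N₀, L₀)` (replicate `k = ⌈(N/N₀)^{1/3}⌉` layers, fill
  by monotonicity in `N` — `groundStateEnergy_mono_particles` of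
  `BoseGasDirichletMonotonicity.lean` — and in the box, and let `ρk³/N → ρ/N₀`).
* `BastiCenatiempoSchlein2021_upperBound_iff_BCS2021` — the two vendored renderings of Thm. 1.1
  (`BastiCenatiempoSchlein2021_upperBound` here, `BCS2021_lhyUpperBound_dirichlet` of
  `DiluteBoseGasLHYUpperBound.lean`) are equivalent.
* `groundStateEnergy_mono_side`, `sideLength_mono` — elementary monotonicity in the box.

What remains for Theorem 1.1 itself is exactly a finite Dirichlet block with the Lee–Huang–Yang
energy at padded density above `ρ` (Prop. 1.3 + Lemma A.1 + the canonical projection of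
Lemma A.4); it is NOT proved here and `BastiCenatiempoSchlein2021_upperBound` stays a named fact.

## References

* [BastiCenatiempoSchlein2021] G. Basti, S. Cenatiempo, B. Schlein, *A new second-order upper bound
  for the ground state energy of dilute Bose gases*, Forum Math. Sigma 9 (2021) e74
  (arXiv:2101.06222): Thm. 1.1, Prop. 1.2, App. A — Lemma A.2 with (A.6)–(A.7), Lemma A.4 with
  (A.13) (pp. 25–27 of the arXiv text).
* [Ruelle1969] D. Ruelle, *Statistical Mechanics: Rigorous Results* (1969), §3.5 (Lemma 2.1.3 is
  the replication step cited by the paper as [R]).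
* [LSSY2005] E. H. Lieb, R. Seiringer, J. P. Solovej, J. Yngvason, *The Mathematics of the Bose Gas
  and its Condensation* (2005), (2.3), (2.52)–(2.53).
-/

noncomputable section

open MeasureTheory Filter Metric
open scoped ENNReal NNReal Topology

namespace Literature.MathematicalPhysics.QuantumManyBody.BoseGas

/-! ### Monotonicity of the Dirichlet ground-state energy in the box -/

/-- **Domain monotonicity of Dirichlet energies.** Enlarging the box lowers the Dirichlet
ground-state energy: `L ≤ L' ⇒ E₀(N, L') ≤ E₀(N, L)` — a trial state vanishing off `Λ_L^N`
vanishes off `Λ_{L'}^N ⊇ Λ_L^N`, with the same energy (the replication steps of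
[BastiCenatiempoSchlein2021, App. A, Lemma A.2 and (A.13)] place Dirichlet states in larger boxes).
[folklore] -/
theorem groundStateEnergy_mono_side {N : ℕ} {L L' : ℝ} (hLL' : L ≤ L') (v : ℝ → ℝ≥0∞) :
    groundStateEnergy v N L' ≤ groundStateEnergy v N L := by
  refine le_iInf fun Ψ ↦ ?_
  have hzero : ∀ X, X ∉ boxN N L' → Ψ.ψ X = 0 := fun X hX ↦
    Ψ.eq_zero X fun hXL ↦ hX fun i k ↦ ⟨(hXL i k).1, (hXL i k).2.trans_le hLL'⟩
  exact iInf_le_of_le (⟨Ψ.ψ, Ψ.contDiff, hzero, Ψ.symm, Ψ.norm_eq⟩ : TrialState N L') le_rfl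

/-- Along the fixed-density sequence the boxes grow: `N ≤ N' ⇒ L_N ≤ L_{N'}` for `ρ > 0`.
[folklore] -/
theorem sideLength_mono {ρ : ℝ} (hρ : 0 < ρ) : Monotone (sideLength ρ) := by
  intro N N' hNN'
  unfold sideLength
  exact Real.rpow_le_rpow (div_nonneg N.cast_nonneg hρ.le)
    (div_le_div_of_nonneg_right (Nat.cast_le.2 hNN') hρ.le) (by norm_num)

/-! ### The same theorem, vendored twice: equivalence with `BCS2021_lhyUpperBound_dirichlet` -/

/-- The two vendored forms of [BastiCenatiempoSchlein2021, Thm. 1.1] are equivalent: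
`BastiCenatiempoSchlein2021_upperBound ↔ BCS2021_lhyUpperBound_dirichlet` (the latter, in
`DiluteBoseGasLHYUpperBound.lean`, differs cosmetically: `v = 0` on `[R, ∞)` instead of `(R, ∞)`,
finite scattering length instead of `𝔞 ≤ R`, the constant `128/(15√π)` written out instead of
`lhyConstant`, and no `0 < C`). Forward: apply the fact with radius `max R 𝔞`; backward: with
radius `R + 1`, enlarging the constant to `max C 1 > 0`. Hence one discharge serves both.
[cite: BastiCenatiempoSchlein2021, Thm. 1.1] -/
theorem BastiCenatiempoSchlein2021_upperBound_iff_BCS2021 :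
    BastiCenatiempoSchlein2021_upperBound ↔ BCS2021_lhyUpperBound_dirichlet := by
  constructor
  · intro h v R hmeas hsupp hL3 hfin
    have hRa : scatteringLength v ≤ ENNReal.ofReal (max R (scatteringLength v).toReal) := by
      rw [← ENNReal.ofReal_toReal hfin]
      exact ENNReal.ofReal_le_ofReal
        (by rw [ENNReal.toReal_ofReal ENNReal.toReal_nonneg]; exact le_max_right _ _)
    obtain ⟨C, ρ₁, -, hρ₁, hmain⟩ := h v (max R (scatteringLength v).toReal) hmeas
      (fun r hr ↦ hsupp r ((le_max_left _ _).trans hr.le)) hL3 hRa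
    refine ⟨C, ρ₁, hρ₁, fun ρ hρ hρ' ↦ ?_⟩
    have h1 := hmain ρ hρ hρ'
    simp only [lhyConstant] at h1 ⊢
    exact h1
  · intro h v R hmeas hsupp hL3 hRa
    have hfin : scatteringLength v ≠ ⊤ := ne_top_of_le_ne_top ENNReal.ofReal_ne_top hRa
    obtain ⟨C, ρ₀, hρ₀, hC⟩ := h v (R + 1) hmeas (fun r hr ↦ hsupp r (by linarith)) hL3 hfin
    refine ⟨max C 1, ρ₀, lt_max_of_lt_right one_pos, hρ₀, fun ρ hρ hρ' ↦ ?_⟩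
    have h1 := hC ρ hρ hρ'
    simp only [lhyConstant] at h1 ⊢
    refine h1.trans (ENNReal.ofReal_le_ofReal ?_)
    gcongr
    exact le_max_left _ _

/-! ### Sums with at most one non-zero term -/

/-- If at most one term of a finite family is non-zero, `‖∑ a_s‖² = ∑ ‖a_s‖²`. [folklore] -/
theorem ennnorm_sum_sq_of_pairwise {ι E : Type*} [Fintype ι] [SeminormedAddCommGroup E]
    (a : ι → E) (h : ∀ s t, s ≠ t → a s = 0 ∨ a t = 0) :
    ((‖∑ s, a s‖₊ : ℝ≥0∞)) ^ 2 = ∑ s, (‖a s‖₊ : ℝ≥0∞) ^ 2 := by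
  classical
  by_cases hex : ∃ s, a s ≠ 0
  · obtain ⟨s₀, hs₀⟩ := hex
    have hz : ∀ t, t ≠ s₀ → a t = 0 := fun t ht ↦ (h t s₀ ht).resolve_right hs₀
    rw [Finset.sum_eq_single s₀ (fun t _ ht ↦ hz t ht) (by simp),
      Finset.sum_eq_single s₀ (fun t _ ht ↦ by rw [hz t ht]; simp) (by simp)]
  · simp only [ne_eq, not_exists, not_not] at hex
    simp [hex]

/-! ### Permuting the particles -/

variable {n m : ℕ}

/-- The sum over ordered pairs of distinct particles is twice the interaction:
`∑_{i ≠ j} v(|xᵢ - xⱼ|) = 2 ∑_{i<j} v(|xᵢ - xⱼ|)`. [folklore] -/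
theorem sum_sum_ne_eq_two_mul_interaction (v : ℝ → ℝ≥0∞) (X : Config n) :
    ∑ i : Fin n, ∑ j : Fin n with j ≠ i, v (dist (X i) (X j)) = 2 * interaction v X := by
  unfold interaction
  have hsplit : ∀ i : Fin n, (∑ j : Fin n with j ≠ i, v (dist (X i) (X j))) =
      (∑ j : Fin n with i < j, v (dist (X i) (X j))) + ∑ j : Fin n with j < i, v (dist (X i) (X j)) := by
    intro i
    rw [← Finset.sum_union]
    · congr 1
      ext j
      simp only [Finset.mem_filter, Finset.mem_univ, true_and, Finset.mem_union]
      exact ⟨fun h ↦ (lt_or_gt_of_ne h).symm, fun h ↦ h.elim ne_of_gt ne_of_lt⟩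
    · rw [Finset.disjoint_filter]
      intro j _ h1 h2
      exact lt_asymm h1 h2
  simp only [hsplit, Finset.sum_add_distrib, two_mul]
  congr 1
  -- swap the roles of `i` and `j` in the second sum
  rw [Finset.sum_comm' (t' := Finset.univ) (s' := fun j ↦ Finset.univ.filter fun i ↦ j < i)]
  · refine Finset.sum_congr rfl fun j _ ↦ Finset.sum_congr rfl fun i _ ↦ ?_
    rw [dist_comm]
  · intro i j
    simp

/-- The interaction is invariant under relabelling the particles. [folklore] -/
theorem interaction_comp_equiv (v : ℝ → ℝ≥0∞) (e : Fin m ≃ Fin n) (X : Config n) :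
    interaction v (fun a ↦ X (e a)) = interaction v X := by
  have h2 : (2 : ℝ≥0∞) ≠ 0 := two_ne_zero
  rw [← ENNReal.mul_right_inj h2 ENNReal.ofNat_ne_top, ← sum_sum_ne_eq_two_mul_interaction,
    ← sum_sum_ne_eq_two_mul_interaction]
  -- both double sums run over ordered pairs of distinct labels
  rw [← e.sum_comp]
  refine Finset.sum_congr rfl fun a _ ↦ ?_
  rw [Finset.sum_filter, Finset.sum_filter, ← e.sum_comp]
  refine Finset.sum_congr rfl fun b _ ↦ ?_
  simp only [ne_eq, e.apply_eq_iff_eq]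

/-- Relabelling the particles, `X ↦ (X_{e(a)})_a`, as a continuous linear equivalence
(`LinearEquiv.funCongrLeft`, made continuous in finite dimension). [folklore] -/
theorem funCongrLeft_toContinuousLinearEquiv_apply (e : Fin m ≃ Fin n) (X : Config n) :
    (LinearEquiv.funCongrLeft ℝ Space e).toContinuousLinearEquiv X = fun a ↦ X (e a) := rfl

/-- The kinetic energy density is covariant under relabelling the particles:
`|∇(F ∘ relabel)|²(X) = |∇F|²(relabel X)`. [folklore] -/
theorem kineticDensity_comp_equiv (e : Fin m ≃ Fin n) (F : Config m → ℂ) (X : Config n) :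
    kineticDensity (fun Y : Config n ↦ F (fun a ↦ Y (e a))) X =
      kineticDensity F (fun a ↦ X (e a)) := by
  set L := (LinearEquiv.funCongrLeft ℝ Space e).toContinuousLinearEquiv with hL
  have hLapp : ∀ Y : Config n, L Y = fun a ↦ Y (e a) := fun Y ↦ rfl
  have hcomp : (fun Y : Config n ↦ F (fun a ↦ Y (e a))) = F ∘ L := by
    funext Y; simp [hLapp]
  unfold kineticDensity
  rw [hcomp, ContinuousLinearEquiv.comp_right_fderiv]
  simp only [ContinuousLinearMap.coe_comp, Function.comp_apply, ContinuousLinearEquiv.coe_coe,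
    hLapp]
  -- the direction `δ_{i,k}` is relabelled to `δ_{e⁻¹ i, k}`
  have hdir : ∀ (i : Fin n) (w : Space),
      (fun a ↦ (Pi.single i w : Config n) (e a)) = Pi.single (e.symm i) w := by
    intro i w
    funext a
    by_cases ha : a = e.symm i
    · subst ha; simp
    · have : e a ≠ i := fun h ↦ ha (by rw [← h, Equiv.symm_apply_apply])
      simp [Pi.single_eq_of_ne this, Pi.single_eq_of_ne ha]
  simp only [hdir]
  exact e.symm.sum_comp (fun a ↦ ∑ k : Fin 3,
    (‖fderiv ℝ F (fun a ↦ X (e a)) (Pi.single a (EuclideanSpace.single k (1 : ℝ)))‖₊ : ℝ≥0∞) ^ 2)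

/-- Lebesgue measure on configuration space is invariant under relabelling the particles.
[folklore] -/
theorem lintegral_comp_equiv (e : Fin m ≃ Fin n) (G : Config m → ℝ≥0∞) :
    ∫⁻ X : Config n, G (fun a ↦ X (e a)) = ∫⁻ Y : Config m, G Y := by
  have hmp := (volume_measurePreserving_piCongrLeft (fun _ : Fin n ↦ Space) e).symm
  exact hmp.lintegral_comp_emb
    (MeasurableEquiv.piCongrLeft (fun _ : Fin n ↦ Space) e).symm.measurableEmbedding G

/-! ### Two blocks of particles: `Fin (N₁ + N₂)` -/

variable {N₁ N₂ : ℕ}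

/-- **Block Tonelli.** `∫ f(X_{block 1}) g(X_{block 2}) dX = (∫ f)(∫ g)`. [folklore] -/
theorem lintegral_block_mul {f : Config N₁ → ℝ≥0∞} {g : Config N₂ → ℝ≥0∞} (hf : Measurable f)
    (hg : Measurable g) :
    ∫⁻ X : Config (N₁ + N₂), f (fun i ↦ X (Fin.castAdd N₂ i)) * g (fun j ↦ X (Fin.natAdd N₁ j)) =
      (∫⁻ Y, f Y) * ∫⁻ Z, g Z := by
  set e := ((MeasurableEquiv.piCongrLeft (fun _ : Fin (N₁ + N₂) ↦ Space) finSumFinEquiv).symm.trans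
    (MeasurableEquiv.sumPiEquivProdPi fun _ : Fin N₁ ⊕ Fin N₂ ↦ Space)) with he
  have hmp : MeasurePreserving e volume (volume.prod volume) :=
    (volume_measurePreserving_piCongrLeft (fun _ : Fin (N₁ + N₂) ↦ Space) finSumFinEquiv).symm.trans
      (volume_measurePreserving_sumPiEquivProdPi fun _ : Fin N₁ ⊕ Fin N₂ ↦ Space)
  have he1 : ∀ X : Config (N₁ + N₂), (e X).1 = fun i ↦ X (Fin.castAdd N₂ i) := by
    intro X; funext i
    simp [he, MeasurableEquiv.sumPiEquivProdPi, Equiv.sumPiEquivProdPi]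
    rfl
  have he2 : ∀ X : Config (N₁ + N₂), (e X).2 = fun j ↦ X (Fin.natAdd N₁ j) := by
    intro X; funext j
    simp [he, MeasurableEquiv.sumPiEquivProdPi, Equiv.sumPiEquivProdPi]
    rfl
  calc ∫⁻ X : Config (N₁ + N₂), f (fun i ↦ X (Fin.castAdd N₂ i)) * g (fun j ↦ X (Fin.natAdd N₁ j))
      = ∫⁻ X : Config (N₁ + N₂), (fun p : Config N₁ × Config N₂ ↦ f p.1 * g p.2) (e X) := by
        refine lintegral_congr fun X ↦ ?_
        simp only [he1, he2]
    _ = ∫⁻ p : Config N₁ × Config N₂, f p.1 * g p.2 ∂(volume.prod volume) :=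
        hmp.lintegral_comp_emb e.measurableEmbedding (fun p : Config N₁ × Config N₂ ↦ f p.1 * g p.2)
    _ = (∫⁻ Y, f Y) * ∫⁻ Z, g Z := lintegral_prod_mul hf.aemeasurable hg.aemeasurable

/-- Splitting the interaction of `N₁ + N₂` particles into the two blocks and the cross terms.
[folklore] -/
theorem interaction_eq_blocks_add_cross (v : ℝ → ℝ≥0∞) (X : Config (N₁ + N₂)) :
    interaction v X = interaction v (fun i ↦ X (Fin.castAdd N₂ i)) +
      interaction v (fun j ↦ X (Fin.natAdd N₁ j)) +
      ∑ i : Fin N₁, ∑ j : Fin N₂, v (dist (X (Fin.castAdd N₂ i)) (X (Fin.natAdd N₁ j))) := by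
  unfold interaction
  simp only [Finset.sum_filter]
  rw [Fin.sum_univ_add]
  simp only [Fin.sum_univ_add]
  have h12 : ∀ (i : Fin N₁) (j : Fin N₂), Fin.castAdd N₂ i < Fin.natAdd N₁ j := by
    intro i j
    rw [Fin.lt_def]
    simp only [Fin.val_castAdd, Fin.val_natAdd]
    omega
  have h21 : ∀ (i : Fin N₂) (j : Fin N₁), ¬ Fin.natAdd N₁ i < Fin.castAdd N₂ j := by
    intro i j
    rw [Fin.lt_def]
    simp only [Fin.val_castAdd, Fin.val_natAdd]
    omega
  simp only [(Fin.strictMono_castAdd N₂).lt_iff_lt, (Fin.strictMono_natAdd N₁).lt_iff_lt, h12,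
    h21, if_true, if_false, Finset.sum_const_zero, zero_add, Finset.sum_add_distrib]
  ring


/-- The projection onto the first block is differentiated coordinatewise: the direction
`δ_{castAdd i, k}` projects to `δ_{i,k}`, the direction `δ_{natAdd j, k}` to `0`. [folklore] -/
theorem single_castAdd_comp_castAdd (i : Fin N₁) (w : Space) :
    (fun i' : Fin N₁ ↦ (Pi.single (Fin.castAdd N₂ i) w : Config (N₁ + N₂)) (Fin.castAdd N₂ i')) =
      Pi.single i w := by
  funext i'
  by_cases h : i' = i
  · subst h; simp
  · simp [Pi.single_eq_of_ne h, Pi.single_eq_of_ne ((Fin.castAdd_injective _ _).ne h)]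

/-- The direction `δ_{castAdd i, ·}` has no component in the second block. [folklore] -/
theorem single_castAdd_comp_natAdd (i : Fin N₁) (w : Space) :
    (fun j : Fin N₂ ↦ (Pi.single (Fin.castAdd N₂ i) w : Config (N₁ + N₂)) (Fin.natAdd N₁ j)) = 0 := by
  funext j
  have : Fin.natAdd N₁ j ≠ Fin.castAdd N₂ i := by
    intro h; have := congrArg Fin.val h; simp [Fin.val_natAdd, Fin.val_castAdd] at this; omega
  simp [Pi.single_eq_of_ne this]

/-- The direction `δ_{natAdd j, ·}` projects to `δ_{j, ·}` in the second block. [folklore] -/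
theorem single_natAdd_comp_natAdd (j : Fin N₂) (w : Space) :
    (fun j' : Fin N₂ ↦ (Pi.single (Fin.natAdd N₁ j) w : Config (N₁ + N₂)) (Fin.natAdd N₁ j')) =
      Pi.single j w := by
  funext j'
  by_cases h : j' = j
  · subst h; simp
  · simp [Pi.single_eq_of_ne h, Pi.single_eq_of_ne ((Fin.natAdd_injective _ _).ne h)]

/-- The direction `δ_{natAdd j, ·}` has no component in the first block. [folklore] -/
theorem single_natAdd_comp_castAdd (j : Fin N₂) (w : Space) :
    (fun i : Fin N₁ ↦ (Pi.single (Fin.natAdd N₁ j) w : Config (N₁ + N₂)) (Fin.castAdd N₂ i)) = 0 := by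
  funext i
  have : Fin.castAdd N₂ i ≠ Fin.natAdd N₁ j := by
    intro h; have := congrArg Fin.val h; simp [Fin.val_natAdd, Fin.val_castAdd] at this; omega
  simp [Pi.single_eq_of_ne this]

/-- **Product rule for a two-block product state.** For `C¹` functions `ψ₁` of the first block
and `ψ₂` of the second, `|∇(ψ₁ ⊗ ψ₂)|² = |∇ψ₁|² |ψ₂|² + |ψ₁|² |∇ψ₂|²` pointwise. [folklore] -/
theorem kineticDensity_blockProd {ψ₁ : Config N₁ → ℂ} {ψ₂ : Config N₂ → ℂ}
    (h₁ : ContDiff ℝ 1 ψ₁) (h₂ : ContDiff ℝ 1 ψ₂) (X : Config (N₁ + N₂)) :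
    kineticDensity (fun Y : Config (N₁ + N₂) ↦
        ψ₁ (fun i ↦ Y (Fin.castAdd N₂ i)) * ψ₂ (fun j ↦ Y (Fin.natAdd N₁ j))) X =
      kineticDensity ψ₁ (fun i ↦ X (Fin.castAdd N₂ i)) *
          (‖ψ₂ (fun j ↦ X (Fin.natAdd N₁ j))‖₊ : ℝ≥0∞) ^ 2 +
        (‖ψ₁ (fun i ↦ X (Fin.castAdd N₂ i))‖₊ : ℝ≥0∞) ^ 2 *
          kineticDensity ψ₂ (fun j ↦ X (Fin.natAdd N₁ j)) := by
  -- the two block projections as continuous linear maps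
  set P₁ : Config (N₁ + N₂) →L[ℝ] Config N₁ :=
    ContinuousLinearMap.pi fun i ↦ ContinuousLinearMap.proj (Fin.castAdd N₂ i) with hP₁
  set P₂ : Config (N₁ + N₂) →L[ℝ] Config N₂ :=
    ContinuousLinearMap.pi fun j ↦ ContinuousLinearMap.proj (Fin.natAdd N₁ j) with hP₂
  have hP₁a : ∀ Y : Config (N₁ + N₂), P₁ Y = fun i ↦ Y (Fin.castAdd N₂ i) := fun Y ↦ rfl
  have hP₂a : ∀ Y : Config (N₁ + N₂), P₂ Y = fun j ↦ Y (Fin.natAdd N₁ j) := fun Y ↦ rfl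
  have hA : ∀ Y, HasFDerivAt (fun Y : Config (N₁ + N₂) ↦ ψ₁ (fun i ↦ Y (Fin.castAdd N₂ i)))
      ((fderiv ℝ ψ₁ (P₁ Y)).comp P₁) Y := fun Y ↦
    ((h₁.differentiable one_ne_zero) _).hasFDerivAt.comp Y P₁.hasFDerivAt
  have hB : ∀ Y, HasFDerivAt (fun Y : Config (N₁ + N₂) ↦ ψ₂ (fun j ↦ Y (Fin.natAdd N₁ j)))
      ((fderiv ℝ ψ₂ (P₂ Y)).comp P₂) Y := fun Y ↦
    ((h₂.differentiable one_ne_zero) _).hasFDerivAt.comp Y P₂.hasFDerivAt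
  have hfd : fderiv ℝ (fun Y : Config (N₁ + N₂) ↦
      ψ₁ (fun i ↦ Y (Fin.castAdd N₂ i)) * ψ₂ (fun j ↦ Y (Fin.natAdd N₁ j))) X =
      ψ₁ (fun i ↦ X (Fin.castAdd N₂ i)) • (fderiv ℝ ψ₂ (P₂ X)).comp P₂ +
        ψ₂ (fun j ↦ X (Fin.natAdd N₁ j)) • (fderiv ℝ ψ₁ (P₁ X)).comp P₁ :=
    ((hA X).mul (hB X)).fderiv
  unfold kineticDensity
  rw [hfd, Fin.sum_univ_add]
  simp only [add_apply, smul_apply, ContinuousLinearMap.coe_comp, Function.comp_apply, hP₁a, hP₂a,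
    smul_eq_mul, single_castAdd_comp_castAdd, single_castAdd_comp_natAdd, single_natAdd_comp_natAdd,
    single_natAdd_comp_castAdd, map_zero, mul_zero, zero_add, add_zero, nnnorm_mul, ENNReal.coe_mul,
    mul_pow, Finset.mul_sum, Finset.sum_mul]
  congr 1
  refine Finset.sum_congr rfl fun i _ ↦ Finset.sum_congr rfl fun k _ ↦ ?_
  ring

/-! ### Permutations adapted to a set of labels -/

/-- For a set `S` of `N₁` of the `N₁ + N₂` labels there is a permutation mapping the first block
onto `S` and the second block onto its complement. [folklore] -/
theorem exists_perm_adapted (S : Finset (Fin (N₁ + N₂))) (hS : S.card = N₁) :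
    ∃ σ : Equiv.Perm (Fin (N₁ + N₂)),
      (∀ i, σ (Fin.castAdd N₂ i) ∈ S) ∧ ∀ j, σ (Fin.natAdd N₁ j) ∉ S := by
  classical
  have hSc : Sᶜ.card = N₂ := by
    rw [Finset.card_compl, Fintype.card_fin, hS]; omega
  let e₁ : Fin N₁ ≃ {i // i ∈ S} := (S.orderIsoOfFin hS).toEquiv
  let e₂ : Fin N₂ ≃ {i // i ∉ S} :=
    (Sᶜ.orderIsoOfFin hSc).toEquiv.trans (Equiv.subtypeEquivRight fun i ↦ Finset.mem_compl)
  let σ : Equiv.Perm (Fin (N₁ + N₂)) :=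
    finSumFinEquiv.symm.trans ((e₁.sumCongr e₂).trans (Equiv.sumCompl fun i ↦ i ∈ S))
  refine ⟨σ, fun i ↦ ?_, fun j ↦ ?_⟩
  · have : σ (Fin.castAdd N₂ i) = (e₁ i : Fin (N₁ + N₂)) := by
      simp [σ, finSumFinEquiv_symm_apply_castAdd]
    rw [this]; exact (e₁ i).2
  · have : σ (Fin.natAdd N₁ j) = (e₂ j : Fin (N₁ + N₂)) := by
      simp [σ, finSumFinEquiv_symm_apply_natAdd]
    rw [this]; exact (e₂ j).2

/-- An adapted permutation maps exactly the first block into `S`: every label of `S` is the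
image of a first-block label. [folklore] -/
theorem exists_castAdd_of_mem {S : Finset (Fin (N₁ + N₂))} {σ : Equiv.Perm (Fin (N₁ + N₂))}
    (hσ₂ : ∀ j, σ (Fin.natAdd N₁ j) ∉ S) {i : Fin (N₁ + N₂)} (hi : i ∈ S) :
    ∃ a, σ (Fin.castAdd N₂ a) = i := by
  obtain ⟨m, rfl⟩ := σ.surjective i
  induction m using Fin.addCases with
  | left a => exact ⟨a, rfl⟩
  | right j => exact absurd hi (hσ₂ j)

/-- Likewise every label outside `S` is the image of a second-block label. [folklore] -/
theorem exists_natAdd_of_not_mem {S : Finset (Fin (N₁ + N₂))} {σ : Equiv.Perm (Fin (N₁ + N₂))}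
    (hσ₁ : ∀ i, σ (Fin.castAdd N₂ i) ∈ S) {i : Fin (N₁ + N₂)} (hi : i ∉ S) :
    ∃ j, σ (Fin.natAdd N₁ j) = i := by
  obtain ⟨m, rfl⟩ := σ.surjective i
  induction m using Fin.addCases with
  | left a => exact absurd (hσ₁ a) hi
  | right j => exact ⟨j, rfl⟩

/-- Two permutations adapted to the same `S` differ by a permutation preserving the blocks; hence
the block product of *symmetric* block functions takes the same value. [folklore] -/
theorem blockProd_comp_eq_of_adapted {S : Finset (Fin (N₁ + N₂))} {σ τ : Equiv.Perm (Fin (N₁ + N₂))}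
    (hσ₁ : ∀ i, σ (Fin.castAdd N₂ i) ∈ S) (hσ₂ : ∀ j, σ (Fin.natAdd N₁ j) ∉ S)
    (hτ₁ : ∀ i, τ (Fin.castAdd N₂ i) ∈ S) (hτ₂ : ∀ j, τ (Fin.natAdd N₁ j) ∉ S)
    {ψ₁ : Config N₁ → ℂ} {ψ₂ : Config N₂ → ℂ}
    (h₁p : ∀ (π : Equiv.Perm (Fin N₁)) (Y : Config N₁), ψ₁ (Y ∘ π) = ψ₁ Y)
    (h₂p : ∀ (π : Equiv.Perm (Fin N₂)) (Z : Config N₂), ψ₂ (Z ∘ π) = ψ₂ Z)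
    (X : Config (N₁ + N₂)) :
    ψ₁ (fun i ↦ X (σ (Fin.castAdd N₂ i))) * ψ₂ (fun j ↦ X (σ (Fin.natAdd N₁ j))) =
      ψ₁ (fun i ↦ X (τ (Fin.castAdd N₂ i))) * ψ₂ (fun j ↦ X (τ (Fin.natAdd N₁ j))) := by
  classical
  -- first block: `σ ∘ castAdd = τ ∘ castAdd ∘ π₁` for a permutation `π₁` of `Fin N₁`
  have hex₁ : ∀ i, ∃ a, τ (Fin.castAdd N₂ a) = σ (Fin.castAdd N₂ i) := fun i ↦
    exists_castAdd_of_mem hτ₂ (hσ₁ i)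
  choose f hf using hex₁
  have hfinj : Function.Injective f := by
    intro i i' h
    have : σ (Fin.castAdd N₂ i) = σ (Fin.castAdd N₂ i') := by rw [← hf i, ← hf i', h]
    exact Fin.castAdd_injective _ _ (σ.injective this)
  let π₁ : Equiv.Perm (Fin N₁) := Equiv.ofBijective f (Finite.injective_iff_bijective.1 hfinj)
  have hex₂ : ∀ j, ∃ b, τ (Fin.natAdd N₁ b) = σ (Fin.natAdd N₁ j) := fun j ↦
    exists_natAdd_of_not_mem hτ₁ (hσ₂ j)
  choose g hg using hex₂
  have hginj : Function.Injective g := by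
    intro j j' h
    have : σ (Fin.natAdd N₁ j) = σ (Fin.natAdd N₁ j') := by rw [← hg j, ← hg j', h]
    exact Fin.natAdd_injective _ _ (σ.injective this)
  let π₂ : Equiv.Perm (Fin N₂) := Equiv.ofBijective g (Finite.injective_iff_bijective.1 hginj)
  have e1 : (fun i ↦ X (σ (Fin.castAdd N₂ i))) = (fun i ↦ X (τ (Fin.castAdd N₂ i))) ∘ π₁ := by
    funext i; simp [π₁, hf]
  have e2 : (fun j ↦ X (σ (Fin.natAdd N₁ j))) = (fun j ↦ X (τ (Fin.natAdd N₁ j))) ∘ π₂ := by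
    funext j; simp [π₂, hg]
  rw [e1, e2, h₁p, h₂p]


/-! ### The relabelled block product `T_σ(X) = ψ₁(X_{σ(block 1)}) ψ₂(X_{σ(block 2)})`

(written out as the lambda `fun X ↦ ψ₁ (fun i ↦ X (σ (Fin.castAdd N₂ i))) * ψ₂ (fun j ↦ X (σ (Fin.natAdd N₁ j)))`). -/


section BlockProd

variable {ψ₁ : Config N₁ → ℂ} {ψ₂ : Config N₂ → ℂ} {U₁ U₂ : Set Space}

/-- The relabelled block product is `C¹` if the factors are. [folklore] -/
theorem contDiff_blockProd (h₁ : ContDiff ℝ 1 ψ₁) (h₂ : ContDiff ℝ 1 ψ₂)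
    (σ : Equiv.Perm (Fin (N₁ + N₂))) : ContDiff ℝ 1 ((fun X : Config (N₁ + N₂) ↦ ψ₁ (fun i ↦ X ((σ) (Fin.castAdd N₂ i))) * ψ₂ (fun j ↦ X ((σ) (Fin.natAdd N₁ j))))) :=
  (h₁.comp (contDiff_pi.2 fun i ↦ contDiff_apply ℝ Space (σ (Fin.castAdd N₂ i)))).mul
    (h₂.comp (contDiff_pi.2 fun j ↦ contDiff_apply ℝ Space (σ (Fin.natAdd N₁ j))))

/-- Where the relabelled block product does not vanish, the first block sits in the support set
of `ψ₁` and the second in that of `ψ₂`. [folklore] -/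
theorem mem_of_blockProd_ne_zero (h₁s : ∀ Y, ψ₁ Y ≠ 0 → ∀ i, Y i ∈ U₁)
    (h₂s : ∀ Z, ψ₂ Z ≠ 0 → ∀ j, Z j ∈ U₂) (σ : Equiv.Perm (Fin (N₁ + N₂)))
    {X : Config (N₁ + N₂)} (hX : (fun X : Config (N₁ + N₂) ↦ ψ₁ (fun i ↦ X ((σ) (Fin.castAdd N₂ i))) * ψ₂ (fun j ↦ X ((σ) (Fin.natAdd N₁ j)))) X ≠ 0) :
    (∀ i, X (σ (Fin.castAdd N₂ i)) ∈ U₁) ∧ ∀ j, X (σ (Fin.natAdd N₁ j)) ∈ U₂ :=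
  ⟨fun i ↦ h₁s _ (left_ne_zero_of_mul hX) i, fun j ↦ h₂s _ (right_ne_zero_of_mul hX) j⟩

/-- **Local vanishing.** If `σ` is adapted to `S` and some particle of `S` is outside the closure
of `U₁`, or some particle outside `S` is outside the closure of `U₂`, then the relabelled block
product vanishes near `X`. [folklore] -/
theorem blockProd_eventuallyEq_zero (h₁s : ∀ Y, ψ₁ Y ≠ 0 → ∀ i, Y i ∈ U₁)
    (h₂s : ∀ Z, ψ₂ Z ≠ 0 → ∀ j, Z j ∈ U₂) {S : Finset (Fin (N₁ + N₂))}
    {σ : Equiv.Perm (Fin (N₁ + N₂))} (hσ₁ : ∀ i, σ (Fin.castAdd N₂ i) ∈ S)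
    (hσ₂ : ∀ j, σ (Fin.natAdd N₁ j) ∉ S) {X : Config (N₁ + N₂)}
    (hX : (∃ i ∈ S, X i ∉ closure U₁) ∨ ∃ i ∉ S, X i ∉ closure U₂) :
    (fun X : Config (N₁ + N₂) ↦ ψ₁ (fun i ↦ X ((σ) (Fin.castAdd N₂ i))) * ψ₂ (fun j ↦ X ((σ) (Fin.natAdd N₁ j)))) =ᶠ[𝓝 X] 0 := by
  rcases hX with ⟨i, hiS, hi⟩ | ⟨i, hiS, hi⟩
  · have hO : IsOpen {Y : Config (N₁ + N₂) | Y i ∈ (closure U₁)ᶜ} :=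
      isClosed_closure.isOpen_compl.preimage (continuous_apply i)
    filter_upwards [hO.mem_nhds hi] with Y hY
    obtain ⟨a, ha⟩ := exists_castAdd_of_mem hσ₂ hiS
    by_contra hne
    exact hY (subset_closure (ha ▸ (mem_of_blockProd_ne_zero h₁s h₂s σ hne).1 a))
  · have hO : IsOpen {Y : Config (N₁ + N₂) | Y i ∈ (closure U₂)ᶜ} :=
      isClosed_closure.isOpen_compl.preimage (continuous_apply i)
    filter_upwards [hO.mem_nhds hi] with Y hY
    obtain ⟨b, hb⟩ := exists_natAdd_of_not_mem hσ₁ hiS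
    by_contra hne
    exact hY (subset_closure (hb ▸ (mem_of_blockProd_ne_zero h₁s h₂s σ hne).2 b))

/-- **Orthogonality of the relabelled products.** For distinct label sets `S ≠ S'` with adapted
permutations, and support sets with disjoint closures, near every configuration one of the two
products vanishes identically. [folklore] -/
theorem blockProd_eventuallyEq_zero_or (hU : Disjoint (closure U₁) (closure U₂))
    (h₁s : ∀ Y, ψ₁ Y ≠ 0 → ∀ i, Y i ∈ U₁) (h₂s : ∀ Z, ψ₂ Z ≠ 0 → ∀ j, Z j ∈ U₂)
    {S S' : Finset (Fin (N₁ + N₂))} (hSS' : S ≠ S')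
    {σ σ' : Equiv.Perm (Fin (N₁ + N₂))} (hσ₁ : ∀ i, σ (Fin.castAdd N₂ i) ∈ S)
    (hσ₂ : ∀ j, σ (Fin.natAdd N₁ j) ∉ S) (hσ'₁ : ∀ i, σ' (Fin.castAdd N₂ i) ∈ S')
    (hσ'₂ : ∀ j, σ' (Fin.natAdd N₁ j) ∉ S') (X : Config (N₁ + N₂)) :
    (fun X : Config (N₁ + N₂) ↦ ψ₁ (fun i ↦ X ((σ) (Fin.castAdd N₂ i))) * ψ₂ (fun j ↦ X ((σ) (Fin.natAdd N₁ j)))) =ᶠ[𝓝 X] 0 ∨ (fun X : Config (N₁ + N₂) ↦ ψ₁ (fun i ↦ X ((σ') (Fin.castAdd N₂ i))) * ψ₂ (fun j ↦ X ((σ') (Fin.natAdd N₁ j)))) =ᶠ[𝓝 X] 0 := by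
  obtain ⟨i, hi⟩ : ∃ i, ¬ (i ∈ S ↔ i ∈ S') := by
    by_contra h
    exact hSS' (Finset.ext fun i ↦ not_not.mp (not_exists.mp h i))
  by_cases hiS : i ∈ S
  · have hiS' : i ∉ S' := fun h' ↦ hi ⟨fun _ ↦ h', fun _ ↦ hiS⟩
    by_cases hx : X i ∈ closure U₁
    · exact Or.inr (blockProd_eventuallyEq_zero h₁s h₂s hσ'₁ hσ'₂
        (Or.inr ⟨i, hiS', Set.disjoint_left.mp hU hx⟩))
    · exact Or.inl (blockProd_eventuallyEq_zero h₁s h₂s hσ₁ hσ₂ (Or.inl ⟨i, hiS, hx⟩))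
  · have hiS' : i ∈ S' := by
      by_contra h'; exact hi ⟨fun h ↦ absurd h hiS, fun h ↦ absurd h h'⟩
    by_cases hx : X i ∈ closure U₁
    · exact Or.inl (blockProd_eventuallyEq_zero h₁s h₂s hσ₁ hσ₂
        (Or.inr ⟨i, hiS, Set.disjoint_left.mp hU hx⟩))
    · exact Or.inr (blockProd_eventuallyEq_zero h₁s h₂s hσ'₁ hσ'₂ (Or.inl ⟨i, hiS', hx⟩))

/-- A function vanishing near `X` has zero derivative at `X`. [folklore] -/
theorem fderiv_eq_zero_of_eventuallyEq_zero {F : Config n → ℂ} {X : Config n}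
    (h : F =ᶠ[𝓝 X] 0) : fderiv ℝ F X = 0 := by
  rw [h.fderiv_eq]; exact fderiv_const_apply 0

/-- The kinetic density of the relabelled block product (covariance under relabelling and the
product rule). [folklore] -/
theorem kineticDensity_blockProd_perm (h₁ : ContDiff ℝ 1 ψ₁) (h₂ : ContDiff ℝ 1 ψ₂)
    (σ : Equiv.Perm (Fin (N₁ + N₂))) (X : Config (N₁ + N₂)) :
    kineticDensity ((fun X : Config (N₁ + N₂) ↦ ψ₁ (fun i ↦ X ((σ) (Fin.castAdd N₂ i))) * ψ₂ (fun j ↦ X ((σ) (Fin.natAdd N₁ j))))) X =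
      kineticDensity ψ₁ (fun i ↦ X (σ (Fin.castAdd N₂ i))) *
          (‖ψ₂ (fun j ↦ X (σ (Fin.natAdd N₁ j)))‖₊ : ℝ≥0∞) ^ 2 +
        (‖ψ₁ (fun i ↦ X (σ (Fin.castAdd N₂ i)))‖₊ : ℝ≥0∞) ^ 2 *
          kineticDensity ψ₂ (fun j ↦ X (σ (Fin.natAdd N₁ j))) := by
  have h := kineticDensity_comp_equiv σ
    (fun Y : Config (N₁ + N₂) ↦ ψ₁ (fun i ↦ Y (Fin.castAdd N₂ i)) * ψ₂ (fun j ↦ Y (Fin.natAdd N₁ j))) X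
  simp only [] at h
  rw [h, kineticDensity_blockProd h₁ h₂]

end BlockProd

/-! ### The merged (symmetrised) state `Ψ = ∑_{|S| = N₁} T_{σ_S}`

The sum over all `N₁`-element label sets `S` of the block product relabelled along the permutation
`σ_S = Classical.choose (exists_perm_adapted S.1 S.2)` adapted to `S` (written out as a lambda). -/


section Merge

variable {ψ₁ : Config N₁ → ℂ} {ψ₂ : Config N₂ → ℂ} {U₁ U₂ : Set Space}

/-- The merged state is `C¹`. [folklore] -/
theorem contDiff_merge (h₁ : ContDiff ℝ 1 ψ₁) (h₂ : ContDiff ℝ 1 ψ₂) :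
    ContDiff ℝ 1 ((fun X : Config (N₁ + N₂) ↦ ∑ S : {S : Finset (Fin (N₁ + N₂)) // S.card = N₁},
        ψ₁ (fun i ↦ X ((Classical.choose (exists_perm_adapted S.1 S.2)) (Fin.castAdd N₂ i))) *
          ψ₂ (fun j ↦ X ((Classical.choose (exists_perm_adapted S.1 S.2)) (Fin.natAdd N₁ j)))) : Config (N₁ + N₂) → ℂ) :=
  ContDiff.sum fun _ _ ↦ contDiff_blockProd h₁ h₂ _

/-- Where the merged state does not vanish, every particle is in `U₁ ∪ U₂`. [folklore] -/
theorem mem_union_of_merge_ne_zero (h₁s : ∀ Y, ψ₁ Y ≠ 0 → ∀ i, Y i ∈ U₁)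
    (h₂s : ∀ Z, ψ₂ Z ≠ 0 → ∀ j, Z j ∈ U₂) {X : Config (N₁ + N₂)}
    (hX : ((fun X : Config (N₁ + N₂) ↦ ∑ S : {S : Finset (Fin (N₁ + N₂)) // S.card = N₁},
        ψ₁ (fun i ↦ X ((Classical.choose (exists_perm_adapted S.1 S.2)) (Fin.castAdd N₂ i))) *
          ψ₂ (fun j ↦ X ((Classical.choose (exists_perm_adapted S.1 S.2)) (Fin.natAdd N₁ j)))) : Config (N₁ + N₂) → ℂ) X ≠ 0) (i : Fin (N₁ + N₂)) : X i ∈ U₁ ∪ U₂ := by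
  obtain ⟨S, -, hS⟩ := Finset.exists_ne_zero_of_sum_ne_zero hX
  set σ := Classical.choose (exists_perm_adapted S.1 S.2)
  have hmem := mem_of_blockProd_ne_zero h₁s h₂s σ hS
  obtain ⟨m, rfl⟩ := σ.surjective i
  induction m using Fin.addCases with
  | left a => exact Or.inl (hmem.1 a)
  | right b => exact Or.inr (hmem.2 b)

/-- The merged state of Bose-symmetric factors is Bose-symmetric. [folklore] -/
theorem merge_comp_perm (h₁p : ∀ (π : Equiv.Perm (Fin N₁)) (Y : Config N₁), ψ₁ (Y ∘ π) = ψ₁ Y)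
    (h₂p : ∀ (π : Equiv.Perm (Fin N₂)) (Z : Config N₂), ψ₂ (Z ∘ π) = ψ₂ Z)
    (τ : Equiv.Perm (Fin (N₁ + N₂))) (X : Config (N₁ + N₂)) :
    ((fun X : Config (N₁ + N₂) ↦ ∑ S : {S : Finset (Fin (N₁ + N₂)) // S.card = N₁},
        ψ₁ (fun i ↦ X ((Classical.choose (exists_perm_adapted S.1 S.2)) (Fin.castAdd N₂ i))) *
          ψ₂ (fun j ↦ X ((Classical.choose (exists_perm_adapted S.1 S.2)) (Fin.natAdd N₁ j)))) : Config (N₁ + N₂) → ℂ) (X ∘ τ) = ((fun X : Config (N₁ + N₂) ↦ ∑ S : {S : Finset (Fin (N₁ + N₂)) // S.card = N₁},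
        ψ₁ (fun i ↦ X ((Classical.choose (exists_perm_adapted S.1 S.2)) (Fin.castAdd N₂ i))) *
          ψ₂ (fun j ↦ X ((Classical.choose (exists_perm_adapted S.1 S.2)) (Fin.natAdd N₁ j)))) : Config (N₁ + N₂) → ℂ) X := by
  -- relabelling the index set `S ↦ τ(S)`
  let Φ : {S : Finset (Fin (N₁ + N₂)) // S.card = N₁} ≃ {S : Finset (Fin (N₁ + N₂)) // S.card = N₁} :=
    τ.finsetCongr.subtypeEquiv fun S ↦ by simp [Finset.card_map]
  simp only [Function.comp_apply]
  refine Fintype.sum_equiv Φ _ _ fun S ↦ ?_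
  -- both `τ ∘ σ_S` and `σ_{τ S}` are adapted to `τ(S)`
  set σ := Classical.choose (exists_perm_adapted S.1 S.2) with hσ
  have hσspec := Classical.choose_spec (exists_perm_adapted S.1 S.2)
  set σ' := Classical.choose (exists_perm_adapted (Φ S).1 (Φ S).2) with hσ'
  have hσ'spec := Classical.choose_spec (exists_perm_adapted (Φ S).1 (Φ S).2)
  have hΦS : ∀ m, m ∈ (Φ S).1 ↔ τ.symm m ∈ S.1 := by
    intro m
    simp [Φ, Equiv.finsetCongr_apply, Finset.mem_map_equiv]
  have hρ₁ : ∀ i, (σ.trans τ) (Fin.castAdd N₂ i) ∈ (Φ S).1 := fun i ↦ by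
    rw [hΦS]; simpa using hσspec.1 i
  have hρ₂ : ∀ j, (σ.trans τ) (Fin.natAdd N₁ j) ∉ (Φ S).1 := fun j ↦ by
    rw [hΦS]; simpa using hσspec.2 j
  exact blockProd_comp_eq_of_adapted hρ₁ hρ₂ hσ'spec.1 hσ'spec.2 h₁p h₂p X

/-- **Pointwise orthogonality of the merge.** With support sets of disjoint closures,
`|Ψ(X)|² = ∑_S |T_{σ_S}(X)|²`. [folklore] -/
theorem ennnorm_merge_sq (hU : Disjoint (closure U₁) (closure U₂))
    (h₁s : ∀ Y, ψ₁ Y ≠ 0 → ∀ i, Y i ∈ U₁) (h₂s : ∀ Z, ψ₂ Z ≠ 0 → ∀ j, Z j ∈ U₂)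
    (X : Config (N₁ + N₂)) :
    ((‖((fun X : Config (N₁ + N₂) ↦ ∑ S : {S : Finset (Fin (N₁ + N₂)) // S.card = N₁},
        ψ₁ (fun i ↦ X ((Classical.choose (exists_perm_adapted S.1 S.2)) (Fin.castAdd N₂ i))) *
          ψ₂ (fun j ↦ X ((Classical.choose (exists_perm_adapted S.1 S.2)) (Fin.natAdd N₁ j)))) : Config (N₁ + N₂) → ℂ) X‖₊ : ℝ≥0∞)) ^ 2 =
      ∑ S : {S : Finset (Fin (N₁ + N₂)) // S.card = N₁},
        (‖ψ₁ (fun i ↦ X ((Classical.choose (exists_perm_adapted S.1 S.2)) (Fin.castAdd N₂ i))) *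
          ψ₂ (fun j ↦ X ((Classical.choose (exists_perm_adapted S.1 S.2)) (Fin.natAdd N₁ j)))‖₊ :
            ℝ≥0∞) ^ 2 := by
  refine ennnorm_sum_sq_of_pairwise _ fun S S' hSS' ↦ ?_
  have hne : S.1 ≠ S'.1 := fun h ↦ hSS' (Subtype.ext h)
  have hσ := Classical.choose_spec (exists_perm_adapted S.1 S.2)
  have hσ' := Classical.choose_spec (exists_perm_adapted S'.1 S'.2)
  rcases blockProd_eventuallyEq_zero_or hU h₁s h₂s hne hσ.1 hσ.2 hσ'.1 hσ'.2 X with h | h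
  · exact Or.inl h.eq_of_nhds
  · exact Or.inr h.eq_of_nhds

/-- **Pointwise orthogonality of the gradients.** With support sets of disjoint closures,
`|∇Ψ(X)|² = ∑_S |∇T_{σ_S}(X)|²`. [folklore] -/
theorem kineticDensity_merge (hU : Disjoint (closure U₁) (closure U₂))
    (h₁ : ContDiff ℝ 1 ψ₁) (h₂ : ContDiff ℝ 1 ψ₂)
    (h₁s : ∀ Y, ψ₁ Y ≠ 0 → ∀ i, Y i ∈ U₁) (h₂s : ∀ Z, ψ₂ Z ≠ 0 → ∀ j, Z j ∈ U₂)
    (X : Config (N₁ + N₂)) :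
    kineticDensity ((fun X : Config (N₁ + N₂) ↦ ∑ S : {S : Finset (Fin (N₁ + N₂)) // S.card = N₁},
        ψ₁ (fun i ↦ X ((Classical.choose (exists_perm_adapted S.1 S.2)) (Fin.castAdd N₂ i))) *
          ψ₂ (fun j ↦ X ((Classical.choose (exists_perm_adapted S.1 S.2)) (Fin.natAdd N₁ j)))) : Config (N₁ + N₂) → ℂ) X =
      ∑ S : {S : Finset (Fin (N₁ + N₂)) // S.card = N₁},
        kineticDensity ((fun X : Config (N₁ + N₂) ↦ ψ₁ (fun i ↦ X ((Classical.choose (exists_perm_adapted S.1 S.2)) (Fin.castAdd N₂ i))) * ψ₂ (fun j ↦ X ((Classical.choose (exists_perm_adapted S.1 S.2)) (Fin.natAdd N₁ j))))) X := by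
  have hsum : ((fun X : Config (N₁ + N₂) ↦ ∑ S : {S : Finset (Fin (N₁ + N₂)) // S.card = N₁},
        ψ₁ (fun i ↦ X ((Classical.choose (exists_perm_adapted S.1 S.2)) (Fin.castAdd N₂ i))) *
          ψ₂ (fun j ↦ X ((Classical.choose (exists_perm_adapted S.1 S.2)) (Fin.natAdd N₁ j)))) : Config (N₁ + N₂) → ℂ) =
      ∑ S : {S : Finset (Fin (N₁ + N₂)) // S.card = N₁},
        ((fun X : Config (N₁ + N₂) ↦ ψ₁ (fun i ↦ X ((Classical.choose (exists_perm_adapted S.1 S.2)) (Fin.castAdd N₂ i))) * ψ₂ (fun j ↦ X ((Classical.choose (exists_perm_adapted S.1 S.2)) (Fin.natAdd N₁ j))))) := by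
    funext X; simp only [Finset.sum_apply]
  unfold kineticDensity
  rw [hsum, fderiv_sum fun S _ ↦ ((contDiff_blockProd h₁ h₂ _).differentiable one_ne_zero) X]
  simp only [_root_.sum_apply]
  have key : ∀ (i : Fin (N₁ + N₂)) (k : Fin 3),
      ((‖∑ S : {S : Finset (Fin (N₁ + N₂)) // S.card = N₁},
          fderiv ℝ ((fun X : Config (N₁ + N₂) ↦ ψ₁ (fun i ↦ X ((Classical.choose (exists_perm_adapted S.1 S.2)) (Fin.castAdd N₂ i))) * ψ₂ (fun j ↦ X ((Classical.choose (exists_perm_adapted S.1 S.2)) (Fin.natAdd N₁ j))))) X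
            (Pi.single i (EuclideanSpace.single k (1 : ℝ)))‖₊ : ℝ≥0∞)) ^ 2 =
        ∑ S : {S : Finset (Fin (N₁ + N₂)) // S.card = N₁},
          (‖fderiv ℝ ((fun X : Config (N₁ + N₂) ↦ ψ₁ (fun i ↦ X ((Classical.choose (exists_perm_adapted S.1 S.2)) (Fin.castAdd N₂ i))) * ψ₂ (fun j ↦ X ((Classical.choose (exists_perm_adapted S.1 S.2)) (Fin.natAdd N₁ j))))) X
            (Pi.single i (EuclideanSpace.single k (1 : ℝ)))‖₊ : ℝ≥0∞) ^ 2 := by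
    intro i k
    refine ennnorm_sum_sq_of_pairwise _ fun S S' hSS' ↦ ?_
    have hne : S.1 ≠ S'.1 := fun h ↦ hSS' (Subtype.ext h)
    have hσ := Classical.choose_spec (exists_perm_adapted S.1 S.2)
    have hσ' := Classical.choose_spec (exists_perm_adapted S'.1 S'.2)
    rcases blockProd_eventuallyEq_zero_or hU h₁s h₂s hne hσ.1 hσ.2 hσ'.1 hσ'.2 X with h | h
    · left; rw [fderiv_eq_zero_of_eventuallyEq_zero h]; rfl
    · right; rw [fderiv_eq_zero_of_eventuallyEq_zero h]; rfl
  simp only [key]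
  symm
  conv_lhs => rw [Finset.sum_comm]
  refine Finset.sum_congr rfl fun i _ ↦ ?_
  rw [Finset.sum_comm]

end Merge


/-! ### Integrals of the relabelled block products -/

section BlockIntegrals

variable {ψ₁ : Config N₁ → ℂ} {ψ₂ : Config N₂ → ℂ} {U₁ U₂ : Set Space}

/-- `∫ f(X_{σ(block 1)}) g(X_{σ(block 2)}) dX = (∫ f)(∫ g)` (relabel, then block Tonelli).
[folklore] -/
theorem lintegral_perm_block_mul (σ : Equiv.Perm (Fin (N₁ + N₂))) {f : Config N₁ → ℝ≥0∞}
    {g : Config N₂ → ℝ≥0∞} (hf : Measurable f) (hg : Measurable g) :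
    ∫⁻ X : Config (N₁ + N₂), f (fun i ↦ X (σ (Fin.castAdd N₂ i))) * g (fun j ↦ X (σ (Fin.natAdd N₁ j))) =
      (∫⁻ Y, f Y) * ∫⁻ Z, g Z := by
  have h := lintegral_comp_equiv σ
    (fun Y : Config (N₁ + N₂) ↦ f (fun i ↦ Y (Fin.castAdd N₂ i)) * g (fun j ↦ Y (Fin.natAdd N₁ j)))
  simp only [] at h
  rw [h, lintegral_block_mul hf hg]

/-- The two-term version of `lintegral_perm_block_mul`. [folklore] -/
theorem lintegral_perm_block_add (σ : Equiv.Perm (Fin (N₁ + N₂))) {f₁ f₂ : Config N₁ → ℝ≥0∞}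
    {g₁ g₂ : Config N₂ → ℝ≥0∞} (hf₁ : Measurable f₁) (hg₁ : Measurable g₁) (hf₂ : Measurable f₂)
    (hg₂ : Measurable g₂) :
    ∫⁻ X : Config (N₁ + N₂),
        (f₁ (fun i ↦ X (σ (Fin.castAdd N₂ i))) * g₁ (fun j ↦ X (σ (Fin.natAdd N₁ j))) +
          f₂ (fun i ↦ X (σ (Fin.castAdd N₂ i))) * g₂ (fun j ↦ X (σ (Fin.natAdd N₁ j)))) =
      (∫⁻ Y, f₁ Y) * (∫⁻ Z, g₁ Z) + (∫⁻ Y, f₂ Y) * ∫⁻ Z, g₂ Z := by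
  have hm : Measurable fun X : Config (N₁ + N₂) ↦
      f₁ (fun i ↦ X (σ (Fin.castAdd N₂ i))) * g₁ (fun j ↦ X (σ (Fin.natAdd N₁ j))) :=
    (hf₁.comp (measurable_pi_lambda _ fun i ↦ measurable_config_apply _)).mul
      (hg₁.comp (measurable_pi_lambda _ fun j ↦ measurable_config_apply _))
  rw [lintegral_add_left hm, lintegral_perm_block_mul σ hf₁ hg₁, lintegral_perm_block_mul σ hf₂ hg₂]

/-- `∫ |T_σ|² = ‖ψ₁‖² ‖ψ₂‖²`. [folklore] -/
theorem lintegral_ennnorm_blockProd_sq (h₁ : ContDiff ℝ 1 ψ₁) (h₂ : ContDiff ℝ 1 ψ₂)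
    (σ : Equiv.Perm (Fin (N₁ + N₂))) :
    ∫⁻ X, ((‖((fun X : Config (N₁ + N₂) ↦ ψ₁ (fun i ↦ X ((σ) (Fin.castAdd N₂ i))) * ψ₂ (fun j ↦ X ((σ) (Fin.natAdd N₁ j))))) X‖₊ : ℝ≥0∞)) ^ 2 =
      (∫⁻ Y, (‖ψ₁ Y‖₊ : ℝ≥0∞) ^ 2) * ∫⁻ Z, (‖ψ₂ Z‖₊ : ℝ≥0∞) ^ 2 := by
  simp only [nnnorm_mul, ENNReal.coe_mul, mul_pow]
  exact lintegral_perm_block_mul σ (measurable_normSq h₁.continuous) (measurable_normSq h₂.continuous)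

/-- `∫ |∇T_σ|² = (∫|∇ψ₁|²) ‖ψ₂‖² + ‖ψ₁‖² ∫|∇ψ₂|²`. [folklore] -/
theorem lintegral_kineticDensity_blockProd (h₁ : ContDiff ℝ 1 ψ₁) (h₂ : ContDiff ℝ 1 ψ₂)
    (σ : Equiv.Perm (Fin (N₁ + N₂))) :
    ∫⁻ X, kineticDensity ((fun X : Config (N₁ + N₂) ↦ ψ₁ (fun i ↦ X ((σ) (Fin.castAdd N₂ i))) * ψ₂ (fun j ↦ X ((σ) (Fin.natAdd N₁ j))))) X =
      (∫⁻ Y, kineticDensity ψ₁ Y) * (∫⁻ Z, (‖ψ₂ Z‖₊ : ℝ≥0∞) ^ 2) +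
        (∫⁻ Y, (‖ψ₁ Y‖₊ : ℝ≥0∞) ^ 2) * ∫⁻ Z, kineticDensity ψ₂ Z := by
  simp only [kineticDensity_blockProd_perm h₁ h₂]
  exact lintegral_perm_block_add σ (measurable_kineticDensity h₁) (measurable_normSq h₂.continuous)
    (measurable_normSq h₁.continuous) (measurable_kineticDensity h₂)

/-- **No interaction across separated blocks.** If the support sets are `R`-separated and `v`
vanishes beyond `R`, then pointwise
`(∑_{i<j} v) |T_σ|² = [(∑_{block 1} v)|ψ₁|²] |ψ₂|² + |ψ₁|² [(∑_{block 2} v)|ψ₂|²]`. [folklore] -/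
theorem interaction_mul_ennnorm_blockProd_sq {R : ℝ} {v : ℝ → ℝ≥0∞} (hv : ∀ r, R < r → v r = 0)
    (hR : ∀ x ∈ U₁, ∀ y ∈ U₂, R < dist x y) (h₁s : ∀ Y, ψ₁ Y ≠ 0 → ∀ i, Y i ∈ U₁)
    (h₂s : ∀ Z, ψ₂ Z ≠ 0 → ∀ j, Z j ∈ U₂) (σ : Equiv.Perm (Fin (N₁ + N₂))) (X : Config (N₁ + N₂)) :
    interaction v X * ((‖((fun X : Config (N₁ + N₂) ↦ ψ₁ (fun i ↦ X ((σ) (Fin.castAdd N₂ i))) * ψ₂ (fun j ↦ X ((σ) (Fin.natAdd N₁ j))))) X‖₊ : ℝ≥0∞)) ^ 2 =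
      interaction v (fun i ↦ X (σ (Fin.castAdd N₂ i))) *
            (‖ψ₁ (fun i ↦ X (σ (Fin.castAdd N₂ i)))‖₊ : ℝ≥0∞) ^ 2 *
          (‖ψ₂ (fun j ↦ X (σ (Fin.natAdd N₁ j)))‖₊ : ℝ≥0∞) ^ 2 +
        (‖ψ₁ (fun i ↦ X (σ (Fin.castAdd N₂ i)))‖₊ : ℝ≥0∞) ^ 2 *
          (interaction v (fun j ↦ X (σ (Fin.natAdd N₁ j))) *
            (‖ψ₂ (fun j ↦ X (σ (Fin.natAdd N₁ j)))‖₊ : ℝ≥0∞) ^ 2) := by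
  by_cases hX : ((fun X : Config (N₁ + N₂) ↦ ψ₁ (fun i ↦ X ((σ) (Fin.castAdd N₂ i))) * ψ₂ (fun j ↦ X ((σ) (Fin.natAdd N₁ j))))) X = 0
  · -- both sides vanish
    have hX' : ψ₁ (fun i ↦ X (σ (Fin.castAdd N₂ i))) = 0 ∨ ψ₂ (fun j ↦ X (σ (Fin.natAdd N₁ j))) = 0 :=
      mul_eq_zero.mp hX
    rw [hX]
    rcases hX' with h | h <;> simp [h]
  · have hmem := mem_of_blockProd_ne_zero h₁s h₂s σ hX
    have hcross : ∑ i : Fin N₁, ∑ j : Fin N₂,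
        v (dist (X (σ (Fin.castAdd N₂ i))) (X (σ (Fin.natAdd N₁ j)))) = 0 :=
      Finset.sum_eq_zero fun i _ ↦ Finset.sum_eq_zero fun j _ ↦
        hv _ (hR _ (hmem.1 i) _ (hmem.2 j))
    have hsplit := interaction_eq_blocks_add_cross v (fun a ↦ X (σ a))
    rw [← interaction_comp_equiv v σ X, hsplit, hcross, add_zero]
    simp only [nnnorm_mul, ENNReal.coe_mul, mul_pow]
    ring

/-- `∫ (∑ v)|T_σ|² = (∫(∑v)|ψ₁|²) ‖ψ₂‖² + ‖ψ₁‖² ∫(∑v)|ψ₂|²` for separated supports. [folklore] -/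
theorem lintegral_interaction_blockProd {R : ℝ} {v : ℝ → ℝ≥0∞} (hv : ∀ r, R < r → v r = 0)
    (hvm : Measurable v) (hR : ∀ x ∈ U₁, ∀ y ∈ U₂, R < dist x y)
    (h₁ : ContDiff ℝ 1 ψ₁) (h₂ : ContDiff ℝ 1 ψ₂)
    (h₁s : ∀ Y, ψ₁ Y ≠ 0 → ∀ i, Y i ∈ U₁) (h₂s : ∀ Z, ψ₂ Z ≠ 0 → ∀ j, Z j ∈ U₂)
    (σ : Equiv.Perm (Fin (N₁ + N₂))) :
    ∫⁻ X, interaction v X * ((‖((fun X : Config (N₁ + N₂) ↦ ψ₁ (fun i ↦ X ((σ) (Fin.castAdd N₂ i))) * ψ₂ (fun j ↦ X ((σ) (Fin.natAdd N₁ j))))) X‖₊ : ℝ≥0∞)) ^ 2 =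
      (∫⁻ Y, interaction v Y * (‖ψ₁ Y‖₊ : ℝ≥0∞) ^ 2) * (∫⁻ Z, (‖ψ₂ Z‖₊ : ℝ≥0∞) ^ 2) +
        (∫⁻ Y, (‖ψ₁ Y‖₊ : ℝ≥0∞) ^ 2) * ∫⁻ Z, interaction v Z * (‖ψ₂ Z‖₊ : ℝ≥0∞) ^ 2 := by
  simp only [interaction_mul_ennnorm_blockProd_sq hv hR h₁s h₂s σ]
  exact lintegral_perm_block_add σ ((measurable_interaction hvm).mul (measurable_normSq h₁.continuous))
    (measurable_normSq h₂.continuous) (measurable_normSq h₁.continuous)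
    ((measurable_interaction hvm).mul (measurable_normSq h₂.continuous))

end BlockIntegrals

/-! ### Integrals of the merged state -/

section MergeIntegrals

variable {ψ₁ : Config N₁ → ℂ} {ψ₂ : Config N₂ → ℂ} {U₁ U₂ : Set Space}

/-- `∫|Ψ|² = #{S} · ‖ψ₁‖² ‖ψ₂‖²`. [folklore] -/
theorem lintegral_ennnorm_merge_sq (hU : Disjoint (closure U₁) (closure U₂))
    (h₁ : ContDiff ℝ 1 ψ₁) (h₂ : ContDiff ℝ 1 ψ₂)
    (h₁s : ∀ Y, ψ₁ Y ≠ 0 → ∀ i, Y i ∈ U₁) (h₂s : ∀ Z, ψ₂ Z ≠ 0 → ∀ j, Z j ∈ U₂) :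
    ∫⁻ X, ((‖((fun X : Config (N₁ + N₂) ↦ ∑ S : {S : Finset (Fin (N₁ + N₂)) // S.card = N₁},
        ψ₁ (fun i ↦ X ((Classical.choose (exists_perm_adapted S.1 S.2)) (Fin.castAdd N₂ i))) *
          ψ₂ (fun j ↦ X ((Classical.choose (exists_perm_adapted S.1 S.2)) (Fin.natAdd N₁ j)))) : Config (N₁ + N₂) → ℂ) X‖₊ : ℝ≥0∞)) ^ 2 =
      (Fintype.card {S : Finset (Fin (N₁ + N₂)) // S.card = N₁} : ℝ≥0∞) *
        ((∫⁻ Y, (‖ψ₁ Y‖₊ : ℝ≥0∞) ^ 2) * ∫⁻ Z, (‖ψ₂ Z‖₊ : ℝ≥0∞) ^ 2) := by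
  simp only [ennnorm_merge_sq hU h₁s h₂s]
  rw [lintegral_finsetSum _ fun S _ ↦ measurable_normSq (contDiff_blockProd h₁ h₂ _).continuous]
  simp only [lintegral_ennnorm_blockProd_sq h₁ h₂, Finset.sum_const, Finset.card_univ, nsmul_eq_mul]

/-- `∫|∇Ψ|² = #{S} · [(∫|∇ψ₁|²)‖ψ₂‖² + ‖ψ₁‖²∫|∇ψ₂|²]`. [folklore] -/
theorem lintegral_kineticDensity_merge (hU : Disjoint (closure U₁) (closure U₂))
    (h₁ : ContDiff ℝ 1 ψ₁) (h₂ : ContDiff ℝ 1 ψ₂)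
    (h₁s : ∀ Y, ψ₁ Y ≠ 0 → ∀ i, Y i ∈ U₁) (h₂s : ∀ Z, ψ₂ Z ≠ 0 → ∀ j, Z j ∈ U₂) :
    ∫⁻ X, kineticDensity ((fun X : Config (N₁ + N₂) ↦ ∑ S : {S : Finset (Fin (N₁ + N₂)) // S.card = N₁},
        ψ₁ (fun i ↦ X ((Classical.choose (exists_perm_adapted S.1 S.2)) (Fin.castAdd N₂ i))) *
          ψ₂ (fun j ↦ X ((Classical.choose (exists_perm_adapted S.1 S.2)) (Fin.natAdd N₁ j)))) : Config (N₁ + N₂) → ℂ) X =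
      (Fintype.card {S : Finset (Fin (N₁ + N₂)) // S.card = N₁} : ℝ≥0∞) *
        ((∫⁻ Y, kineticDensity ψ₁ Y) * (∫⁻ Z, (‖ψ₂ Z‖₊ : ℝ≥0∞) ^ 2) +
          (∫⁻ Y, (‖ψ₁ Y‖₊ : ℝ≥0∞) ^ 2) * ∫⁻ Z, kineticDensity ψ₂ Z) := by
  simp only [kineticDensity_merge hU h₁ h₂ h₁s h₂s]
  rw [lintegral_finsetSum _ fun S _ ↦ measurable_kineticDensity (contDiff_blockProd h₁ h₂ _)]
  simp only [lintegral_kineticDensity_blockProd h₁ h₂, Finset.sum_const, Finset.card_univ,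
    nsmul_eq_mul]

/-- `∫(∑v)|Ψ|² = #{S} · [(∫(∑v)|ψ₁|²)‖ψ₂‖² + ‖ψ₁‖²∫(∑v)|ψ₂|²]` for separated supports. [folklore] -/
theorem lintegral_interaction_merge {R : ℝ} {v : ℝ → ℝ≥0∞} (hv : ∀ r, R < r → v r = 0)
    (hvm : Measurable v) (hU : Disjoint (closure U₁) (closure U₂))
    (hR : ∀ x ∈ U₁, ∀ y ∈ U₂, R < dist x y) (h₁ : ContDiff ℝ 1 ψ₁) (h₂ : ContDiff ℝ 1 ψ₂)
    (h₁s : ∀ Y, ψ₁ Y ≠ 0 → ∀ i, Y i ∈ U₁) (h₂s : ∀ Z, ψ₂ Z ≠ 0 → ∀ j, Z j ∈ U₂) :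
    ∫⁻ X, interaction v X * ((‖((fun X : Config (N₁ + N₂) ↦ ∑ S : {S : Finset (Fin (N₁ + N₂)) // S.card = N₁},
        ψ₁ (fun i ↦ X ((Classical.choose (exists_perm_adapted S.1 S.2)) (Fin.castAdd N₂ i))) *
          ψ₂ (fun j ↦ X ((Classical.choose (exists_perm_adapted S.1 S.2)) (Fin.natAdd N₁ j)))) : Config (N₁ + N₂) → ℂ) X‖₊ : ℝ≥0∞)) ^ 2 =
      (Fintype.card {S : Finset (Fin (N₁ + N₂)) // S.card = N₁} : ℝ≥0∞) *
        ((∫⁻ Y, interaction v Y * (‖ψ₁ Y‖₊ : ℝ≥0∞) ^ 2) * (∫⁻ Z, (‖ψ₂ Z‖₊ : ℝ≥0∞) ^ 2) +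
          (∫⁻ Y, (‖ψ₁ Y‖₊ : ℝ≥0∞) ^ 2) * ∫⁻ Z, interaction v Z * (‖ψ₂ Z‖₊ : ℝ≥0∞) ^ 2) := by
  simp only [ennnorm_merge_sq hU h₁s h₂s, Finset.mul_sum]
  have hmeas : ∀ S : {S : Finset (Fin (N₁ + N₂)) // S.card = N₁},
      Measurable fun X : Config (N₁ + N₂) ↦ interaction v X *
        (‖ψ₁ (fun i ↦ X ((Classical.choose (exists_perm_adapted S.1 S.2)) (Fin.castAdd N₂ i))) *
          ψ₂ (fun j ↦ X ((Classical.choose (exists_perm_adapted S.1 S.2)) (Fin.natAdd N₁ j)))‖₊ :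
            ℝ≥0∞) ^ 2 :=
    fun S ↦ (measurable_interaction hvm).mul (measurable_normSq (contDiff_blockProd h₁ h₂ _).continuous)
  rw [lintegral_finsetSum _ fun S _ ↦ hmeas S]
  simp only [lintegral_interaction_blockProd hv hvm hR h₁ h₂ h₁s h₂s, Finset.sum_const,
    Finset.card_univ, nsmul_eq_mul]

/-- The index set of the merge is non-empty: the first block itself is an `N₁`-set. [folklore] -/
theorem card_labelSets_pos : 0 < Fintype.card {S : Finset (Fin (N₁ + N₂)) // S.card = N₁} :=
  Fintype.card_pos_iff.2 ⟨⟨(Finset.univ : Finset (Fin N₁)).map (Fin.castAddEmb N₂), by simp⟩⟩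

end MergeIntegrals

/-! ### The merge theorem -/

/-- **Merging two Dirichlet-type states with separated supports.** Let `ψ₁` (`N₁` particles) and
`ψ₂` (`N₂` particles) be `C¹`, Bose-symmetric, normalised wave functions whose particles live in
sets `U₁`, `U₂ ⊂ ℝ³` with disjoint closures and mutual distances `> R`, and let `v` vanish beyond
`R`. Then there is a `C¹`, Bose-symmetric, normalised `(N₁ + N₂)`-particle wave function with all
particles in `U₁ ∪ U₂` whose energy `∫ |∇Ψ|² + ∑_{i<j} v |Ψ|²` is the **sum** of the two energies
(the symmetrised, normalised product; no interaction between the groups). This is the mechanism of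
the replication Lemma A.2 and of (A.13) of [BastiCenatiempoSchlein2021, App. A] ("thanks to the
corridors of size `R` between the boxes particles in different boxes do not interact").
[cite: BastiCenatiempoSchlein2021, App. A, Lemma A.2 and (A.13)] -/
theorem exists_merge {U₁ U₂ : Set Space} {R : ℝ} {v : ℝ → ℝ≥0∞} (hv : ∀ r, R < r → v r = 0)
    (hvm : Measurable v) (hU : Disjoint (closure U₁) (closure U₂))
    (hR : ∀ x ∈ U₁, ∀ y ∈ U₂, R < dist x y)
    {ψ₁ : Config N₁ → ℂ} (h₁ : ContDiff ℝ 1 ψ₁) (h₁s : ∀ Y, ψ₁ Y ≠ 0 → ∀ i, Y i ∈ U₁)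
    (h₁p : ∀ (π : Equiv.Perm (Fin N₁)) (Y : Config N₁), ψ₁ (Y ∘ π) = ψ₁ Y)
    (h₁n : ∫⁻ Y, (‖ψ₁ Y‖₊ : ℝ≥0∞) ^ 2 = 1)
    {ψ₂ : Config N₂ → ℂ} (h₂ : ContDiff ℝ 1 ψ₂) (h₂s : ∀ Z, ψ₂ Z ≠ 0 → ∀ j, Z j ∈ U₂)
    (h₂p : ∀ (π : Equiv.Perm (Fin N₂)) (Z : Config N₂), ψ₂ (Z ∘ π) = ψ₂ Z)
    (h₂n : ∫⁻ Z, (‖ψ₂ Z‖₊ : ℝ≥0∞) ^ 2 = 1) :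
    ∃ Ψ : Config (N₁ + N₂) → ℂ, ContDiff ℝ 1 Ψ ∧ (∀ X, Ψ X ≠ 0 → ∀ i, X i ∈ U₁ ∪ U₂) ∧
      (∀ (π : Equiv.Perm (Fin (N₁ + N₂))) (X : Config (N₁ + N₂)), Ψ (X ∘ π) = Ψ X) ∧
      ∫⁻ X, (‖Ψ X‖₊ : ℝ≥0∞) ^ 2 = 1 ∧
      ∫⁻ X, kineticDensity Ψ X + interaction v X * (‖Ψ X‖₊ : ℝ≥0∞) ^ 2 =
        (∫⁻ Y, kineticDensity ψ₁ Y + interaction v Y * (‖ψ₁ Y‖₊ : ℝ≥0∞) ^ 2) +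
          ∫⁻ Z, kineticDensity ψ₂ Z + interaction v Z * (‖ψ₂ Z‖₊ : ℝ≥0∞) ^ 2 := by
  set κ : ℕ := Fintype.card {S : Finset (Fin (N₁ + N₂)) // S.card = N₁} with hκ_def
  have hκ : 0 < κ := card_labelSets_pos
  have hκ0 : (κ : ℝ≥0∞) ≠ 0 := Nat.cast_ne_zero.2 hκ.ne'
  have hκtop : (κ : ℝ≥0∞) ≠ ⊤ := ENNReal.natCast_ne_top κ
  set c : ℝ := Real.sqrt ((κ : ℝ)⁻¹) with hc_def
  have hc0 : 0 ≤ c := Real.sqrt_nonneg _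
  have hc2 : ENNReal.ofReal (c ^ 2) = (κ : ℝ≥0∞)⁻¹ := by
    rw [hc_def, Real.sq_sqrt (inv_nonneg.2 (Nat.cast_nonneg κ)),
      ENNReal.ofReal_inv_of_pos (Nat.cast_pos.2 hκ), ENNReal.ofReal_natCast]
  have hcκ : ENNReal.ofReal (c ^ 2) * κ = 1 := by rw [hc2]; exact ENNReal.inv_mul_cancel hκ0 hκtop
  have hM := contDiff_merge (ψ₁ := ψ₁) (ψ₂ := ψ₂) h₁ h₂
  refine ⟨fun X ↦ (c : ℂ) * ((fun X : Config (N₁ + N₂) ↦ ∑ S : {S : Finset (Fin (N₁ + N₂)) // S.card = N₁},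
        ψ₁ (fun i ↦ X ((Classical.choose (exists_perm_adapted S.1 S.2)) (Fin.castAdd N₂ i))) *
          ψ₂ (fun j ↦ X ((Classical.choose (exists_perm_adapted S.1 S.2)) (Fin.natAdd N₁ j)))) : Config (N₁ + N₂) → ℂ) X, contDiff_const.mul hM,
    fun X hX i ↦ mem_union_of_merge_ne_zero h₁s h₂s (right_ne_zero_of_mul hX) i,
    fun π X ↦ by
      show (c : ℂ) * ((fun X : Config (N₁ + N₂) ↦ ∑ S : {S : Finset (Fin (N₁ + N₂)) // S.card = N₁},
        ψ₁ (fun i ↦ X ((Classical.choose (exists_perm_adapted S.1 S.2)) (Fin.castAdd N₂ i))) *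
          ψ₂ (fun j ↦ X ((Classical.choose (exists_perm_adapted S.1 S.2)) (Fin.natAdd N₁ j)))) : Config (N₁ + N₂) → ℂ) (X ∘ π) =
        (c : ℂ) * ((fun X : Config (N₁ + N₂) ↦ ∑ S : {S : Finset (Fin (N₁ + N₂)) // S.card = N₁},
        ψ₁ (fun i ↦ X ((Classical.choose (exists_perm_adapted S.1 S.2)) (Fin.castAdd N₂ i))) *
          ψ₂ (fun j ↦ X ((Classical.choose (exists_perm_adapted S.1 S.2)) (Fin.natAdd N₁ j)))) : Config (N₁ + N₂) → ℂ) X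
      rw [merge_comp_perm h₁p h₂p π X], ?_, ?_⟩
  · simp only [ennorm_real_mul_sq c hc0]
    rw [lintegral_const_mul' _ _ ENNReal.ofReal_ne_top, lintegral_ennnorm_merge_sq hU h₁ h₂ h₁s h₂s,
      h₁n, h₂n, mul_one, mul_one, hcκ]
  · have hkin : ∀ X, kineticDensity (fun X ↦ (c : ℂ) * ((fun X : Config (N₁ + N₂) ↦ ∑ S : {S : Finset (Fin (N₁ + N₂)) // S.card = N₁},
        ψ₁ (fun i ↦ X ((Classical.choose (exists_perm_adapted S.1 S.2)) (Fin.castAdd N₂ i))) *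
          ψ₂ (fun j ↦ X ((Classical.choose (exists_perm_adapted S.1 S.2)) (Fin.natAdd N₁ j)))) : Config (N₁ + N₂) → ℂ) X) X =
        ENNReal.ofReal (c ^ 2) * kineticDensity ((fun X : Config (N₁ + N₂) ↦ ∑ S : {S : Finset (Fin (N₁ + N₂)) // S.card = N₁},
        ψ₁ (fun i ↦ X ((Classical.choose (exists_perm_adapted S.1 S.2)) (Fin.castAdd N₂ i))) *
          ψ₂ (fun j ↦ X ((Classical.choose (exists_perm_adapted S.1 S.2)) (Fin.natAdd N₁ j)))) : Config (N₁ + N₂) → ℂ) X :=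
      kineticDensity_const_mul hM c hc0
    simp only [hkin, ennorm_real_mul_sq c hc0]
    have hmeas : Measurable fun X ↦ kineticDensity ((fun X : Config (N₁ + N₂) ↦ ∑ S : {S : Finset (Fin (N₁ + N₂)) // S.card = N₁},
        ψ₁ (fun i ↦ X ((Classical.choose (exists_perm_adapted S.1 S.2)) (Fin.castAdd N₂ i))) *
          ψ₂ (fun j ↦ X ((Classical.choose (exists_perm_adapted S.1 S.2)) (Fin.natAdd N₁ j)))) : Config (N₁ + N₂) → ℂ) X :=
      measurable_kineticDensity hM
    calc ∫⁻ X, ENNReal.ofReal (c ^ 2) * kineticDensity ((fun X : Config (N₁ + N₂) ↦ ∑ S : {S : Finset (Fin (N₁ + N₂)) // S.card = N₁},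
        ψ₁ (fun i ↦ X ((Classical.choose (exists_perm_adapted S.1 S.2)) (Fin.castAdd N₂ i))) *
          ψ₂ (fun j ↦ X ((Classical.choose (exists_perm_adapted S.1 S.2)) (Fin.natAdd N₁ j)))) : Config (N₁ + N₂) → ℂ) X +
          interaction v X * (ENNReal.ofReal (c ^ 2) *
            ((‖((fun X : Config (N₁ + N₂) ↦ ∑ S : {S : Finset (Fin (N₁ + N₂)) // S.card = N₁},
        ψ₁ (fun i ↦ X ((Classical.choose (exists_perm_adapted S.1 S.2)) (Fin.castAdd N₂ i))) *
          ψ₂ (fun j ↦ X ((Classical.choose (exists_perm_adapted S.1 S.2)) (Fin.natAdd N₁ j)))) : Config (N₁ + N₂) → ℂ) X‖₊ : ℝ≥0∞)) ^ 2)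
        = ENNReal.ofReal (c ^ 2) * ((∫⁻ X, kineticDensity ((fun X : Config (N₁ + N₂) ↦ ∑ S : {S : Finset (Fin (N₁ + N₂)) // S.card = N₁},
        ψ₁ (fun i ↦ X ((Classical.choose (exists_perm_adapted S.1 S.2)) (Fin.castAdd N₂ i))) *
          ψ₂ (fun j ↦ X ((Classical.choose (exists_perm_adapted S.1 S.2)) (Fin.natAdd N₁ j)))) : Config (N₁ + N₂) → ℂ) X) +
            ∫⁻ X, interaction v X * ((‖((fun X : Config (N₁ + N₂) ↦ ∑ S : {S : Finset (Fin (N₁ + N₂)) // S.card = N₁},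
        ψ₁ (fun i ↦ X ((Classical.choose (exists_perm_adapted S.1 S.2)) (Fin.castAdd N₂ i))) *
          ψ₂ (fun j ↦ X ((Classical.choose (exists_perm_adapted S.1 S.2)) (Fin.natAdd N₁ j)))) : Config (N₁ + N₂) → ℂ) X‖₊ : ℝ≥0∞)) ^ 2) := by
          rw [← lintegral_add_left hmeas, ← lintegral_const_mul' _ _ ENNReal.ofReal_ne_top]
          refine lintegral_congr fun X ↦ ?_
          ring
      _ = (∫⁻ Y, kineticDensity ψ₁ Y + interaction v Y * (‖ψ₁ Y‖₊ : ℝ≥0∞) ^ 2) +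
          ∫⁻ Z, kineticDensity ψ₂ Z + interaction v Z * (‖ψ₂ Z‖₊ : ℝ≥0∞) ^ 2 := by
          rw [lintegral_kineticDensity_merge hU h₁ h₂ h₁s h₂s,
            lintegral_interaction_merge hv hvm hU hR h₁ h₂ h₁s h₂s, h₁n, h₂n,
            lintegral_add_left (measurable_kineticDensity h₁),
            lintegral_add_left (measurable_kineticDensity h₂), ← mul_add, ← mul_assoc, hcκ]
          ring


/-! ### Translating a Dirichlet state; packaging a raw state -/

/-- **Translation.** A Dirichlet trial state on `Λ_L`, translated by `u`, is a `C¹`, Bose-symmetric,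
normalised wave function with all particles in `u + Λ_L` and the same energy (Lebesgue measure and
`|xᵢ - xⱼ|` are translation invariant). [folklore] -/
theorem exists_translate {N : ℕ} {L : ℝ} (v : ℝ → ℝ≥0∞) (Φ : TrialState N L) (u : Space) :
    ∃ ψ : Config N → ℂ, ContDiff ℝ 1 ψ ∧ (∀ X, ψ X ≠ 0 → ∀ i, X i ∈ {x : Space | x - u ∈ box L}) ∧
      (∀ (π : Equiv.Perm (Fin N)) (X : Config N), ψ (X ∘ π) = ψ X) ∧
      ∫⁻ X, (‖ψ X‖₊ : ℝ≥0∞) ^ 2 = 1 ∧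
      ∫⁻ X, kineticDensity ψ X + interaction v X * (‖ψ X‖₊ : ℝ≥0∞) ^ 2 = energy v Φ := by
  refine ⟨fun X ↦ Φ.ψ (X - fun _ ↦ u), Φ.contDiff.comp (contDiff_id.sub contDiff_const),
    ?_, ?_, ?_, ?_⟩
  · intro X hX i
    by_contra hi
    exact hX (Φ.eq_zero _ fun h ↦ hi (h i))
  · intro π X
    show Φ.ψ (X ∘ π - fun _ ↦ u) = Φ.ψ (X - fun _ ↦ u)
    have : (X ∘ π - fun _ ↦ u) = (X - fun _ ↦ u) ∘ π := rfl
    rw [this, Φ.symm]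
  · have h := lintegral_sub_right_eq_self (μ := (volume : Measure (Config N)))
      (fun X : Config N ↦ (‖Φ.ψ X‖₊ : ℝ≥0∞) ^ 2) (fun _ ↦ u)
    rw [Φ.norm_eq] at h
    exact h
  · have hkin : ∀ X, kineticDensity (fun X ↦ Φ.ψ (X - fun _ ↦ u)) X =
        kineticDensity Φ.ψ (X - fun _ ↦ u) := by
      intro X
      unfold kineticDensity
      have hd : HasFDerivAt (fun X : Config N ↦ Φ.ψ (X - fun _ ↦ u))
          ((fderiv ℝ Φ.ψ (X - fun _ ↦ u)).comp (ContinuousLinearMap.id ℝ (Config N))) X :=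
        ((Φ.contDiff.differentiable one_ne_zero) _).hasFDerivAt.comp X
          ((hasFDerivAt_id X).sub_const _)
      rw [hd.fderiv, ContinuousLinearMap.comp_id]
    have hint : ∀ X : Config N, interaction v (X - fun _ ↦ u) = interaction v X := by
      intro X; unfold interaction; simp
    have h := lintegral_sub_right_eq_self (μ := (volume : Measure (Config N)))
      (fun X : Config N ↦ kineticDensity Φ.ψ X + interaction v X * (‖Φ.ψ X‖₊ : ℝ≥0∞) ^ 2) (fun _ ↦ u)
    simp only [hint] at h
    simp only [hkin]
    exact h

/-- **Packaging.** A `C¹`, Bose-symmetric, normalised wave function all of whose particles stay in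
`Λ_L` is a Dirichlet trial state, so its energy bounds `E₀(N, L)` (variational principle).
[cite: LSSY2005, (2.3)] -/
theorem groundStateEnergy_le_of_raw {N : ℕ} {L : ℝ} (v : ℝ → ℝ≥0∞) {ψ : Config N → ℂ}
    (hc : ContDiff ℝ 1 ψ) (hs : ∀ X, ψ X ≠ 0 → ∀ i, X i ∈ box L)
    (hp : ∀ (π : Equiv.Perm (Fin N)) (X : Config N), ψ (X ∘ π) = ψ X)
    (hn : ∫⁻ X, (‖ψ X‖₊ : ℝ≥0∞) ^ 2 = 1) :
    groundStateEnergy v N L ≤ ∫⁻ X, kineticDensity ψ X + interaction v X * (‖ψ X‖₊ : ℝ≥0∞) ^ 2 :=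
  groundStateEnergy_le_energy v
    ⟨ψ, hc, fun X hX ↦ Classical.by_contradiction fun h ↦ hX fun i ↦ hs X h i, hp, hn⟩

/-- **Two separated boxes (the two-box case of Lemma A.2 / (A.13)).** If the translated boxes
`u₁ + Λ_{L₁}` and `u₂ + Λ_{L₂}` lie in `Λ_L` and their closures are at mutual distance `> R ≥ 0`,
the range of `v`, then `E₀(N₁ + N₂, L) ≤ E₀(N₁, L₁) + E₀(N₂, L₂)`: Dirichlet states of the two
boxes merge into a Dirichlet state of `Λ_L` without interaction between the boxes.
[cite: BastiCenatiempoSchlein2021, App. A, Lemma A.2 and (A.13)] -/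
theorem groundStateEnergy_add_le_add {L₁ L₂ L R : ℝ} {v : ℝ → ℝ≥0∞}
    (hv : ∀ r, R < r → v r = 0) (hvm : Measurable v) (hR : 0 ≤ R) (u₁ u₂ : Space)
    (hsep : ∀ x ∈ closure {x : Space | x - u₁ ∈ box L₁}, ∀ y ∈ closure {y : Space | y - u₂ ∈ box L₂},
      R < dist x y)
    (h₁L : ∀ x : Space, x - u₁ ∈ box L₁ → x ∈ box L) (h₂L : ∀ y : Space, y - u₂ ∈ box L₂ → y ∈ box L) :
    groundStateEnergy v (N₁ + N₂) L ≤ groundStateEnergy v N₁ L₁ + groundStateEnergy v N₂ L₂ := by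
  have hU : Disjoint (closure {x : Space | x - u₁ ∈ box L₁}) (closure {y : Space | y - u₂ ∈ box L₂}) := by
    rw [Set.disjoint_left]
    intro x hx hx'
    have := hsep x hx x hx'
    rw [dist_self] at this
    exact absurd this (not_lt.2 hR)
  have hR' : ∀ x ∈ {x : Space | x - u₁ ∈ box L₁}, ∀ y ∈ {y : Space | y - u₂ ∈ box L₂}, R < dist x y :=
    fun x hx y hy ↦ hsep x (subset_closure hx) y (subset_closure hy)
  unfold groundStateEnergy
  rw [ENNReal.iInf_add]
  refine le_iInf fun Φ₁ ↦ ?_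
  rw [ENNReal.add_iInf]
  refine le_iInf fun Φ₂ ↦ ?_
  obtain ⟨ψ₁, h₁, h₁s, h₁p, h₁n, h₁E⟩ := exists_translate v Φ₁ u₁
  obtain ⟨ψ₂, h₂, h₂s, h₂p, h₂n, h₂E⟩ := exists_translate v Φ₂ u₂
  obtain ⟨Ψ, hΨ, hΨs, hΨp, hΨn, hΨE⟩ := exists_merge hv hvm hU hR' h₁ h₁s h₁p h₁n h₂ h₂s h₂p h₂n
  have hbox : ∀ X, Ψ X ≠ 0 → ∀ i, X i ∈ box L := by
    intro X hX i
    rcases hΨs X hX i with h | h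
    · exact h₁L _ h
    · exact h₂L _ h
  calc ⨅ Ψ : TrialState (N₁ + N₂) L, energy v Ψ = groundStateEnergy v (N₁ + N₂) L := rfl
    _ ≤ _ := groundStateEnergy_le_of_raw v hΨ hbox hΨp hΨn
    _ = energy v Φ₁ + energy v Φ₂ := by rw [hΨE, h₁E, h₂E]

/-! ### Replication along separated translates (Lemma A.2 / (A.13), canonical form) -/

section Replicate

variable {N₀ : ℕ} {L₀ R : ℝ} {v : ℝ → ℝ≥0∞}

/-- **Iterated merge.** Given a Dirichlet block state `Φ` of `N₀` particles in `Λ_{L₀}` and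
translates `u 0, u 1, …` whose boxes `u a + Λ_{L₀}` (`a < K`) have closures at mutual distances
`> R ≥ 0` (the range of `v`), for every `m ≤ K` there is a `C¹`, Bose-symmetric, normalised wave
function of `N₀ m` particles, all in `⋃_{a<m} (u a + Λ_{L₀})`, with energy exactly `m · 𝓔[Φ]`
("placing `m` copies of the state in adjacent boxes … particles in different boxes do not
interact"). [cite: BastiCenatiempoSchlein2021, App. A, Lemma A.2 and proof of (A.13)] -/
theorem exists_replicate (hv : ∀ r, R < r → v r = 0) (hvm : Measurable v) (hR : 0 ≤ R)
    (Φ : TrialState N₀ L₀) (u : ℕ → Space) (K : ℕ)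
    (hsep : ∀ a < K, ∀ b < K, a ≠ b → ∀ x ∈ closure {x : Space | x - u a ∈ box L₀},
      ∀ y ∈ closure {y : Space | y - u b ∈ box L₀}, R < dist x y) :
    ∀ m ≤ K, ∃ Ψ : Config (N₀ * m) → ℂ, ContDiff ℝ 1 Ψ ∧
      (∀ X, Ψ X ≠ 0 → ∀ i, X i ∈ {x : Space | ∃ a < m, x - u a ∈ box L₀}) ∧
      (∀ (π : Equiv.Perm (Fin (N₀ * m))) (X : Config (N₀ * m)), Ψ (X ∘ π) = Ψ X) ∧
      ∫⁻ X, (‖Ψ X‖₊ : ℝ≥0∞) ^ 2 = 1 ∧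
      ∫⁻ X, kineticDensity Ψ X + interaction v X * (‖Ψ X‖₊ : ℝ≥0∞) ^ 2 = m * energy v Φ := by
  intro m
  induction m with
  | zero =>
    intro _
    haveI : IsEmpty (Fin (N₀ * 0)) := ⟨fun i ↦ (Fin.cast (Nat.mul_zero N₀) i).elim0⟩
    refine ⟨fun _ ↦ 1, contDiff_const, fun X _ i ↦ isEmptyElim i, fun π X ↦ rfl, ?_, ?_⟩
    · rw [lintegral_const, volume_pi, Measure.pi_univ]
      simp
    · simp [kineticDensity, interaction]
  | succ m ih =>
    intro hm
    have hmK : m < K := Nat.lt_of_succ_le hm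
    obtain ⟨Ψ, hΨ, hΨs, hΨp, hΨn, hΨE⟩ := ih hmK.le
    obtain ⟨ψ, hψ, hψs, hψp, hψn, hψE⟩ := exists_translate v Φ (u m)
    -- the union of the first `m` boxes as a finite union, and its closure
    have hUeq : {x : Space | ∃ a < m, x - u a ∈ box L₀} = ⋃ a ∈ Set.Iio m, {x : Space | x - u a ∈ box L₀} := by
      ext x; simp
    have hcl : closure {x : Space | ∃ a < m, x - u a ∈ box L₀} ⊆
        ⋃ a ∈ Set.Iio m, closure {x : Space | x - u a ∈ box L₀} := by
      rw [hUeq, (Set.finite_Iio m).closure_biUnion]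
    have hU : Disjoint (closure {x : Space | ∃ a < m, x - u a ∈ box L₀})
        (closure {x : Space | x - u m ∈ box L₀}) := by
      rw [Set.disjoint_left]
      intro x hx hx'
      obtain ⟨a, ha, hxa⟩ := Set.mem_iUnion₂.1 (hcl hx)
      have ha' : a < m := ha
      have := hsep a (ha'.trans hmK) m hmK ha'.ne x hxa x hx'
      rw [dist_self] at this
      exact absurd this (not_lt.2 hR)
    have hR' : ∀ x ∈ {x : Space | ∃ a < m, x - u a ∈ box L₀}, ∀ y ∈ {y : Space | y - u m ∈ box L₀},
        R < dist x y := by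
      rintro x ⟨a, ha, hxa⟩ y hy
      exact hsep a (ha.trans hmK) m hmK ha.ne x (subset_closure hxa) y (subset_closure hy)
    obtain ⟨Ψ', h', h's, h'p, h'n, h'E⟩ :=
      exists_merge hv hvm hU hR' hΨ hΨs hΨp hΨn hψ hψs hψp hψn
    refine ⟨Ψ', h', fun X hX i ↦ ?_, h'p, h'n, ?_⟩
    · rcases h's X hX i with ⟨a, ha, hxa⟩ | h
      · exact ⟨a, ha.trans m.lt_succ_self, hxa⟩
      · exact ⟨m, m.lt_succ_self, h⟩
    · show ∫⁻ X : Config (N₀ * m + N₀),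
          kineticDensity Ψ' X + interaction v X * (‖Ψ' X‖₊ : ℝ≥0∞) ^ 2 = _
      rw [h'E, hΨE, hψE, Nat.cast_succ]
      ring

/-- **Replication bound.** With `K > 0` separated translated boxes inside `Λ_L`,
`E₀^D(N₀ K, L) ≤ K · E₀^D(N₀, L₀)`. [cite: BastiCenatiempoSchlein2021, App. A, (A.13)] -/
theorem groundStateEnergy_mul_le (hv : ∀ r, R < r → v r = 0) (hvm : Measurable v) (hR : 0 ≤ R)
    (u : ℕ → Space) {K : ℕ} (hK : 0 < K)
    (hsep : ∀ a < K, ∀ b < K, a ≠ b → ∀ x ∈ closure {x : Space | x - u a ∈ box L₀},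
      ∀ y ∈ closure {y : Space | y - u b ∈ box L₀}, R < dist x y)
    {L : ℝ} (hin : ∀ a < K, ∀ x : Space, x - u a ∈ box L₀ → x ∈ box L) :
    groundStateEnergy v (N₀ * K) L ≤ K * groundStateEnergy v N₀ L₀ := by
  have hK0 : (K : ℝ≥0∞) ≠ 0 := Nat.cast_ne_zero.2 hK.ne'
  rw [groundStateEnergy, groundStateEnergy, ENNReal.mul_iInf_of_ne hK0 (ENNReal.natCast_ne_top K)]
  refine le_iInf fun Φ ↦ ?_
  obtain ⟨Ψ, hΨ, hΨs, hΨp, hΨn, hΨE⟩ := exists_replicate hv hvm hR Φ u K hsep K le_rfl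
  rw [← hΨE]
  exact groundStateEnergy_le_of_raw v hΨ
    (fun X hX i ↦ by obtain ⟨a, ha, hxa⟩ := hΨs X hX i; exact hin a ha _ hxa) hΨp hΨn

end Replicate

/-! ### A cubic lattice of boxes -/

section Lattice

open WithLp

variable {L₀ R d : ℝ}

/-- A coordinate difference is bounded by the Euclidean distance. [folklore] -/
theorem abs_sub_apply_le_dist (x y : Space) (k : Fin 3) : |x k - y k| ≤ dist x y := by
  rw [EuclideanSpace.dist_eq]
  calc |x k - y k| = Real.sqrt (|x k - y k| ^ 2) := by rw [Real.sqrt_sq (abs_nonneg _)]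
    _ ≤ Real.sqrt (∑ j, dist (x j) (y j) ^ 2) := by
        refine Real.sqrt_le_sqrt ?_
        have : |x k - y k| ^ 2 = dist (x k) (y k) ^ 2 := by rw [Real.dist_eq]
        rw [this]
        exact Finset.single_le_sum (f := fun j ↦ dist (x j) (y j) ^ 2) (fun j _ ↦ sq_nonneg _)
          (Finset.mem_univ k)

/-- The closure of a translated open box is contained in the translated closed box. [folklore] -/
theorem closure_translate_box_subset (u : Space) (L₀ : ℝ) :
    closure {x : Space | x - u ∈ box L₀} ⊆ {x : Space | ∀ k, x k - u k ∈ Set.Icc 0 L₀} := by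
  refine closure_minimal (fun x hx k ↦ Set.Ioo_subset_Icc_self (hx k)) ?_
  have : {x : Space | ∀ k, x k - u k ∈ Set.Icc 0 L₀} = ⋂ k, (fun x : Space ↦ x k - u k) ⁻¹' Set.Icc 0 L₀ := by
    ext x; simp
  rw [this]
  exact isClosed_iInter fun k ↦ isClosed_Icc.preimage (by fun_prop)

/-- **Lattice separation.** Boxes `L₀`-wide at distinct sites of the lattice `d ℤ³` with
`L₀ + R < d` have closures at mutual distances `> R`. [folklore] -/
theorem lt_dist_of_latticeVec_ne (hd : L₀ + R < d) (hL₀ : 0 ≤ L₀) (hR : 0 ≤ R) {n n' : Fin 3 → ℤ}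
    (hnn' : n ≠ n')
    {x y : Space} (hx : x ∈ closure {x : Space | x - latticeVec d n ∈ box L₀})
    (hy : y ∈ closure {y : Space | y - latticeVec d n' ∈ box L₀}) : R < dist x y := by
  obtain ⟨k, hk⟩ : ∃ k, n k ≠ n' k := by
    by_contra h
    exact hnn' (funext fun k ↦ not_not.mp (not_exists.mp h k))
  have hxk := closure_translate_box_subset _ _ hx k
  have hyk := closure_translate_box_subset _ _ hy k
  simp only [latticeVec, PiLp.toLp_apply, Set.mem_Icc] at hxk hyk
  have hd0 : 0 < d := by linarith
  refine lt_of_lt_of_le ?_ (abs_sub_apply_le_dist x y k)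
  -- the sites differ by at least `d` in coordinate `k`
  rcases lt_or_gt_of_ne hk with h | h
  · have h1 : (n k : ℝ) + 1 ≤ n' k := by exact_mod_cast h
    have : d * (n k : ℝ) + d ≤ d * n' k := by nlinarith
    rw [abs_sub_comm, abs_of_pos (by linarith)]
    linarith
  · have h1 : (n' k : ℝ) + 1 ≤ n k := by exact_mod_cast h
    have : d * (n' k : ℝ) + d ≤ d * n k := by nlinarith
    rw [abs_of_pos (by linarith)]
    linarith

/-- A box at a lattice site with digits in `{0, …, k-1}` lies in `Λ_{kd}`. [folklore] -/
theorem mem_box_of_latticeVec {k : ℕ} (hd : L₀ < d) {n : Fin 3 → ℤ} (hn0 : ∀ j, 0 ≤ n j)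
    (hnk : ∀ j, n j + 1 ≤ k) {x : Space} (hx : x - latticeVec d n ∈ box L₀) : x ∈ box (k * d) := by
  intro j
  have hxj := hx j
  simp only [PiLp.sub_apply, latticeVec, Set.mem_Ioo] at hxj
  have hL : 0 < L₀ := by linarith [hxj.1, hxj.2]
  have hd0 : 0 < d := hL.trans hd
  have h0 : (0 : ℝ) ≤ n j := by exact_mod_cast hn0 j
  have h1 : (n j : ℝ) + 1 ≤ k := by exact_mod_cast hnk j
  constructor
  · nlinarith [hxj.1]
  · nlinarith [hxj.2]

/-- Mixed-radix digits `(a mod k, ⌊a/k⌋ mod k, ⌊a/k²⌋)` of `a < k³` are `< k`. [folklore] -/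
theorem digit_lt {k a : ℕ} (hk : 0 < k) (ha : a < k ^ 3) (j : Fin 3) :
    (![a % k, a / k % k, a / (k * k)] : Fin 3 → ℕ) j < k := by
  fin_cases j
  · exact Nat.mod_lt _ hk
  · exact Nat.mod_lt _ hk
  · show a / (k * k) < k
    rw [Nat.div_lt_iff_lt_mul (Nat.mul_pos hk hk)]
    calc a < k ^ 3 := ha
      _ = k * (k * k) := by ring

/-- The mixed-radix digits determine `a`. [folklore] -/
theorem eq_of_digits_eq {k a b : ℕ}
    (h : (![a % k, a / k % k, a / (k * k)] : Fin 3 → ℕ) = ![b % k, b / k % k, b / (k * k)]) : a = b := by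
  have h0 := congr_fun h 0
  have h1 := congr_fun h 1
  have h2 := congr_fun h 2
  simp only [Matrix.cons_val_zero, Matrix.cons_val_one, Matrix.cons_val] at h0 h1 h2
  have ha : a = a % k + k * (a / k % k + k * (a / (k * k))) := by
    rw [← Nat.div_div_eq_div_mul, Nat.mod_add_div, Nat.mod_add_div]
  have hb : b = b % k + k * (b / k % k + k * (b / (k * k))) := by
    rw [← Nat.div_div_eq_div_mul, Nat.mod_add_div, Nat.mod_add_div]
  rw [ha, hb, h0, h1, h2]

/-- **Replication on the cubic lattice.** For `L₀ + R < d` (`L₀, R ≥ 0`) and `k ≥ 1`, the `k³` boxes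
`d·n + Λ_{L₀}`, `n ∈ {0,…,k-1}³`, are `R`-separated and lie in `Λ_{kd}`, so
`E₀^D(N₀ k³, kd) ≤ k³ E₀^D(N₀, L₀)`. [cite: BastiCenatiempoSchlein2021, App. A, Lemma A.2 and (A.13)] -/
theorem groundStateEnergy_lattice_le {N₀ : ℕ} {v : ℝ → ℝ≥0∞} (hv : ∀ r, R < r → v r = 0)
    (hvm : Measurable v) (hR : 0 ≤ R) (hL₀ : 0 ≤ L₀) (hd : L₀ + R < d) {k : ℕ} (hk : 0 < k) :
    groundStateEnergy v (N₀ * k ^ 3) (k * d) ≤ ((k ^ 3 : ℕ) : ℝ≥0∞) * groundStateEnergy v N₀ L₀ := by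
  -- the lattice sites, enumerated by `a < k³`
  let dig : ℕ → Fin 3 → ℕ := fun a ↦ ![a % k, a / k % k, a / (k * k)]
  let u : ℕ → Space := fun a ↦ latticeVec d fun j ↦ (dig a j : ℤ)
  have hK : 0 < k ^ 3 := pow_pos hk 3
  refine groundStateEnergy_mul_le hv hvm hR u hK ?_ ?_
  · intro a ha b hb hab x hx y hy
    have hne : (fun j ↦ (dig a j : ℤ)) ≠ fun j ↦ (dig b j : ℤ) := by
      intro h
      apply hab
      refine eq_of_digits_eq (k := k) (funext fun j ↦ ?_)
      exact_mod_cast congr_fun h j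
    exact lt_dist_of_latticeVec_ne hd hL₀ hR hne hx hy
  · intro a ha x hx
    refine mem_box_of_latticeVec (by linarith) (fun j ↦ by positivity) (fun j ↦ ?_) hx
    have := digit_lt hk ha j
    show (((![a % k, a / k % k, a / (k * k)] : Fin 3 → ℕ) j : ℕ) : ℤ) + 1 ≤ (k : ℤ)
    omega

end Lattice


/-! ### The thermodynamic `limsup` is bounded by any separated block (canonical content of App. A) -/

section Thermodynamic

variable {R : ℝ} {v : ℝ → ℝ≥0∞}

/-- **The thermodynamic-limit energy density is bounded by any finite Dirichlet block.** Let `v`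
vanish beyond `R ≥ 0` and let `Λ_{L₀}` (`L₀ ≥ 0`) be a block whose `R`-padded copies can be packed
at density above `ρ`: `L₀ + R < d`, `ρ d³ < N₀`. Then along the fixed-density boxes
`L_N = (N/ρ)^{1/3}`,
`limsup_N E₀^D(N, L_N)/L_N³ ≤ (ρ/N₀) · E₀^D(N₀, L₀)`:
for each `N` take `k = ⌈(N/N₀)^{1/3}⌉`, so that `N ≤ N₀k³` (monotonicity in `N`) and eventually
`kd ≤ L_N` (domain monotonicity), and replicate the block `k³` times (`E₀(N₀k³, kd) ≤ k³E₀(N₀, L₀)`);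
finally `ρk³/N → ρ/N₀`. This is the canonical (fixed particle number) version of the replication
argument (A.13) and of Lemma A.2 of [BastiCenatiempoSchlein2021, App. A].
[cite: BastiCenatiempoSchlein2021, App. A, (A.13) and Lemma A.2] -/
theorem limsup_energyDensity_le_of_block (hv : ∀ r, R < r → v r = 0) (hvm : Measurable v) (hR : 0 ≤ R)
    {N₀ : ℕ} (hN₀ : 0 < N₀) {L₀ : ℝ} (hL₀ : 0 ≤ L₀) {ρ d : ℝ} (hρ : 0 < ρ) (hd : L₀ + R < d)
    (hρd : ρ * d ^ 3 < N₀) :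
    limsup (fun N : ℕ ↦ groundStateEnergy v N (sideLength ρ N) / ENNReal.ofReal (sideLength ρ N ^ 3))
        atTop ≤ ENNReal.ofReal (ρ / N₀) * groundStateEnergy v N₀ L₀ := by
  set E₀ := groundStateEnergy v N₀ L₀ with hE₀
  have hd0 : 0 < d := by linarith
  have hN₀' : (0 : ℝ) < N₀ := Nat.cast_pos.2 hN₀
  -- trivial if `E₀ = ⊤`
  rcases eq_or_ne E₀ ⊤ with htop | htop
  · rw [htop, ENNReal.mul_top (ne_of_gt (ENNReal.ofReal_pos.2 (div_pos hρ hN₀')))]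
    exact le_top
  -- `t_N = (N/N₀)^{1/3}`, `k_N = ⌈t_N⌉`
  set t : ℕ → ℝ := fun N ↦ ((N : ℝ) / N₀) ^ ((1 : ℝ) / 3) with ht
  set k : ℕ → ℕ := fun N ↦ ⌈t N⌉₊ with hk
  have ht0 : ∀ N, 0 ≤ t N := fun N ↦ Real.rpow_nonneg (div_nonneg (Nat.cast_nonneg N) hN₀'.le) _
  have ht3 : ∀ N : ℕ, t N ^ 3 = N / N₀ := fun N ↦ by
    rw [ht]
    simp only []
    rw [← Real.rpow_natCast, ← Real.rpow_mul (div_nonneg (Nat.cast_nonneg N) hN₀'.le)]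
    norm_num
  have htk : ∀ N, t N ≤ k N := fun N ↦ Nat.le_ceil _
  have hkt : ∀ N, (k N : ℝ) < t N + 1 := fun N ↦ Nat.ceil_lt_add_one (ht0 N)
  have hNk : ∀ N : ℕ, N ≤ N₀ * k N ^ 3 := by
    intro N
    have h1 : (N : ℝ) / N₀ ≤ (k N : ℝ) ^ 3 := by
      rw [← ht3]; exact pow_le_pow_left₀ (ht0 N) (htk N) 3
    rw [div_le_iff₀ hN₀'] at h1
    exact_mod_cast (by linarith : (N : ℝ) ≤ N₀ * (k N : ℝ) ^ 3)
  -- `t_N → ∞`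
  have htend : Tendsto t atTop atTop :=
    (tendsto_rpow_atTop (by norm_num : (0 : ℝ) < 1 / 3)).comp
      (tendsto_natCast_atTop_atTop.atTop_div_const hN₀')
  -- the side `k_N d` eventually fits into `L_N = t_N (N₀/ρ)^{1/3}`
  set θ : ℝ := ((N₀ : ℝ) / ρ) ^ ((1 : ℝ) / 3) with hθ
  have hdθ : d < θ := by
    have h1 : d ^ 3 < N₀ / ρ := by rw [lt_div_iff₀ hρ]; linarith
    calc d = (d ^ 3) ^ ((1 : ℝ) / 3) := by
          rw [show ((1 : ℝ) / 3) = ((3 : ℕ) : ℝ)⁻¹ by norm_num, Real.pow_rpow_inv_natCast hd0.le (by norm_num)]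
      _ < θ := Real.rpow_lt_rpow (by positivity) h1 (by norm_num)
  have hside : ∀ N : ℕ, sideLength ρ N = t N * θ := by
    intro N
    rw [sideLength, ht, hθ]
    simp only []
    rw [← Real.mul_rpow (div_nonneg (Nat.cast_nonneg N) hN₀'.le) (div_nonneg hN₀'.le hρ.le)]
    congr 1
    field_simp
  have hfit : ∀ᶠ N : ℕ in atTop, (k N : ℝ) * d ≤ sideLength ρ N := by
    filter_upwards [htend.eventually_ge_atTop (d / (θ - d))] with N hN
    rw [hside]
    have h1 : d ≤ t N * (θ - d) := by rwa [div_le_iff₀ (sub_pos.2 hdθ)] at hN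
    nlinarith [hkt N, hd0, ht0 N]
  -- the eventual bound on the energy density
  have hbound : ∀ᶠ N : ℕ in atTop,
      groundStateEnergy v N (sideLength ρ N) / ENNReal.ofReal (sideLength ρ N ^ 3) ≤
        ENNReal.ofReal (ρ * (k N : ℝ) ^ 3 / N) * E₀ := by
    filter_upwards [hfit, eventually_gt_atTop 0] with N hfitN hN
    have hN' : (0 : ℝ) < N := Nat.cast_pos.2 hN
    have htpos : 0 < t N := Real.rpow_pos_of_pos (div_pos hN' hN₀') _
    have hkpos : 0 < k N := Nat.ceil_pos.2 htpos
    have h1 : groundStateEnergy v N (sideLength ρ N) ≤ ((k N ^ 3 : ℕ) : ℝ≥0∞) * E₀ :=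
      (groundStateEnergy_mono_particles hvm (sideLength ρ N) (hNk N)).trans
        ((groundStateEnergy_mono_side hfitN v).trans (groundStateEnergy_lattice_le hv hvm hR hL₀ hd hkpos))
    have hL3 : ENNReal.ofReal (sideLength ρ N ^ 3) = ENNReal.ofReal (N / ρ) := by
      congr 1
      rw [sideLength, ← Real.rpow_natCast, ← Real.rpow_mul (div_nonneg (Nat.cast_nonneg N) hρ.le)]
      norm_num
    have hne0 : ENNReal.ofReal (N / ρ) ≠ 0 := (ENNReal.ofReal_pos.2 (div_pos hN' hρ)).ne'
    rw [hL3, ENNReal.div_le_iff_le_mul (Or.inl hne0) (Or.inl ENNReal.ofReal_ne_top)]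
    calc groundStateEnergy v N (sideLength ρ N) ≤ ((k N ^ 3 : ℕ) : ℝ≥0∞) * E₀ := h1
      _ = ENNReal.ofReal (ρ * (k N : ℝ) ^ 3 / N) * E₀ * ENNReal.ofReal (N / ρ) := by
          have hρ0 : ρ ≠ 0 := hρ.ne'
          have hN0 : (N : ℝ) ≠ 0 := hN'.ne'
          rw [mul_assoc, mul_comm E₀, ← mul_assoc, ← ENNReal.ofReal_mul (by positivity)]
          congr 1
          rw [show ((k N ^ 3 : ℕ) : ℝ≥0∞) = ENNReal.ofReal ((k N : ℝ) ^ 3) by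
            rw [← ENNReal.ofReal_natCast]; push_cast; rfl]
          congr 1
          field_simp
  -- the comparison sequence tends to `(ρ/N₀) E₀`
  have hreal : Tendsto (fun N : ℕ ↦ ρ * (k N : ℝ) ^ 3 / N) atTop (𝓝 (ρ / N₀)) := by
    have hup : Tendsto (fun N : ℕ ↦ ρ / N₀ * (1 + (t N)⁻¹) ^ 3) atTop (𝓝 (ρ / N₀)) := by
      have : Tendsto (fun N : ℕ ↦ ρ / N₀ * (1 + (t N)⁻¹) ^ 3) atTop (𝓝 (ρ / N₀ * (1 + 0) ^ 3)) :=
        tendsto_const_nhds.mul ((tendsto_const_nhds.add (tendsto_inv_atTop_zero.comp htend)).pow 3)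
      simpa using this
    refine tendsto_of_tendsto_of_tendsto_of_le_of_le' tendsto_const_nhds hup ?_ ?_
    · filter_upwards [eventually_gt_atTop 0] with N hN
      have hN' : (0 : ℝ) < N := Nat.cast_pos.2 hN
      rw [div_le_div_iff₀ hN₀' hN']
      have := hNk N
      have : (N : ℝ) ≤ N₀ * (k N : ℝ) ^ 3 := by exact_mod_cast this
      nlinarith
    · filter_upwards [eventually_gt_atTop 0] with N hN
      have hN' : (0 : ℝ) < N := Nat.cast_pos.2 hN
      have htpos : 0 < t N := Real.rpow_pos_of_pos (div_pos hN' hN₀') _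
      have hk3 : (k N : ℝ) ^ 3 ≤ (t N * (1 + (t N)⁻¹)) ^ 3 := by
        refine pow_le_pow_left₀ (Nat.cast_nonneg _) ?_ 3
        rw [mul_add, mul_one, mul_inv_cancel₀ htpos.ne']
        exact (hkt N).le
      rw [mul_pow, ht3] at hk3
      rw [div_le_iff₀ hN']
      calc ρ * (k N : ℝ) ^ 3 ≤ ρ * ((N : ℝ) / N₀ * (1 + (t N)⁻¹) ^ 3) := by gcongr
        _ = ρ / N₀ * (1 + (t N)⁻¹) ^ 3 * N := by field_simp
  have hlim : Tendsto (fun N : ℕ ↦ ENNReal.ofReal (ρ * (k N : ℝ) ^ 3 / N) * E₀) atTop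
      (𝓝 (ENNReal.ofReal (ρ / N₀) * E₀)) :=
    ENNReal.Tendsto.mul_const (ENNReal.tendsto_ofReal hreal) (Or.inr htop)
  exact (limsup_le_limsup hbound).trans (le_of_eq hlim.limsup_eq)

end Thermodynamic

end Literature.MathematicalPhysics.QuantumManyBody.BoseGas

end
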